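import Literature.Computability.AlgebraicComplexity.DDS21DepthThreeDiagonalToolkit
import Literature.RingTheory.MvPolynomial.WeightOperators
import Mathlib.RingTheory.MvPowerSeries.Order
import Mathlib.RingTheory.MvPowerSeries.NoZeroDivisors
import Mathlib.RingTheory.MvPowerSeries.Inverse
import Mathlib.RingTheory.MvPowerSeries.Trunc
import Mathlib.Algebra.Order.Antidiag.Finsupp
import Mathlib.Algebra.MvPolynomial.Derivation
import Mathlib.Algebra.MvPolynomial.PDeriv
import Mathlib.RingTheory.MvPolynomial.Homogeneous
import Mathlib.RingTheory.Derivation.Basic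
import Mathlib.Algebra.TrivSqZeroExt.Basic
import Mathlib.RingTheory.Localization.FractionRing
import HarnessLib

/-!
# DDS21 Thm. 3.2 (de-bordering `Σ^{[k]}ΠΣ`), brick B4a: graded fractions

Theorem-and-definition companion (cell `val-lit`, np lane, DDS21 Thm 3.2 programme "M-b", brick
**B4a** of the memo `HOME/np/MEMO-t21g12-DDS21-B4-DiDIL.md` §2, frame R0 of lead-np RULING
(132)(a)) for the DiDIL induction of P. Dutta, P. Dwivedi, N. Saxena, *Demystifying the border
of depth-3 algebraic circuits*, FOCS 2021, FULL VERSION `paper:galaxy-pdf-7641649743695546420`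
(SIAM-style printed line numbers `Lnnn`), §3 "Proof of Theorem 3.2", p0027 L724 – p0036 L964
[DuttaDwivediSaxena2022]. `DDS2021_thm_3_2` itself stays an OPEN named fact; this file is the
algebra the later bricks (B4b `DiDILStep`, B4c `DiDILApprox`, B5 trace-back) compute with.

## The graded frame (what is rendered, and how it differs from print)

The source applies `Φ : x_i ↦ z·x_i + α_i` (p0028 L751–754) and works over
`R_j = F(ε)[z]/(z^{d_j})` ("`z` cost-free", L755), dividing ("Divide", L765, L808) and
differentiating in `z` ("Derive", (3.1) L766–767, (3.2) L811–812). After the shift by `α`, `Φ` is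
pure scaling, so the coefficient of `z^c` is the HOMOGENEOUS COMPONENT of total degree `c` in
`x`, `val_z` is the LOWEST DEGREE, "mod `z^D`" is TRUNCATION below total degree `D`, and `z∂_z` is
the EULER DERIVATION `E = ∑_i x_i ∂_i` (memo finding F2). This file supplies exactly these four
notions with their calculus, for polynomials, for power series (where the source's
`R_j`-inverses of `ΠΣ`-products live: "`1/R` does not contain negative powers", Claim 3.3
proof, p0027 L737–744), and for the fraction field `K(x)` (where the memo's EXACT DiDIL objects
`T_{i,j+1} := E(T_{i,j}/T̃_{m,j})` live, memo R1). Disclosed cosmetic deviation (memo R0): the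
Euler valuation of a `z`-derivative is the print's `z`-valuation `+ 1`.

## Contents (all statements PROVED; definitions have bodies; no named facts)

* §1 `degEq`, `degLT` (exponents by total degree), `hpart c` (degree-`c` part of a power series
  as a polynomial — Mathlib's `truncFinset`), `jet N` (truncation below degree `N`);
  `hpart_mul` (Cauchy product by degree), `jet_mul_jet` (jets are multiplicative),
  `hpart_coe = homogeneousComponent`, `jet_coe`.
* §2 `euler` (the derivation `E` with `E x_i = x_i`, = the tree's `weightOp 1` /
  `∑_i x_i ∂_i`: `euler_eq_weightOp_one`, `euler_eq_sum_X_mul_pderiv`), `coeff_euler`,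
  `homogeneousComponent_euler`, `euler_of_isHomogeneous`, `euler_map`, `euler_eq_zero_iff`;
  `eulerSeries` (the same on `K[[x]]`), `hpart_eulerSeries`, `eulerSeries_mul_inv`.
* §3 `locDeriv`: extension of ANY derivation of a commutative ring `A` to ANY localization `L`
  (built through the dual numbers `L[ε]/(ε²)` and `IsLocalization.lift`), `locDeriv_algebraMap`,
  uniqueness `eq_locDeriv`, quotient rule `locDeriv_mk'_mul`; `eulerFrac` = `E` on any model of
  `K(x)`, `eulerFrac_div`, `eulerFrac_div_algebraMap`.
* §4 `ldeg` / `initialForm` (lowest degree / lowest homogeneous component, via Mathlib's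
  `MvPowerSeries.order`): `ldeg_mul`, `initialForm_mul` (domain), `min_ldeg_le_ldeg_add`,
  `ldeg_eq_zero_iff`, `ldeg_lt_ldeg_sub_initialForm`, `mul_geom_sum₂_initialForm` (the graded
  geometric identity behind division by a NON-unit, for B5).
* §5 `gcomp p Q c` — degree-`c` piece of `p/Q` for `Q(0) ≠ 0` (a POLYNOMIAL): representation
  independence `gcomp_congr`, `gcomp_mul` (convolution), `gcomp_add`, `gcomp_euler`,
  `gcomp_C_mul/_add_left/_sub_left`, `jet_mul_sum_gcomp` (`Q·∑_{c<N} gcomp ≡ p` below `N`),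
  uniqueness of graded division `homogeneousComponent_eq_gcomp`, the division-free formulas
  `gcomp_eq_homogeneousComponent_mul_invJet` and `C_pow_mul_gcomp` (`a^{c+1}·gcomp = (p·adjJet)_c`,
  `map_adjJet` — the form that reduces modulo `ε`), and the model computation of eq. (3.3)
  (p0032 L858–862): `gcomp_one_affine`, `gcomp_linear_affine` (pieces of `1/(a+m)` and of
  `m/(a+m) = Eℓ/ℓ` are single powers of the linear form `m`).
* §6 `homogeneousComponent_affinePow`, `homogeneousComponent_mem_swsClass`
  (`f ∈ Σ∧Σ(t,e) ⇒ f_u ∈ Σ∧Σ(t,u)`), `sum_homogeneousComponent_mem_swsClass` — the graded form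
  of the source's coefficient extraction in `z` (Lemma 2.14, p0021 L571–576) with budgets.

Honest framing: algebra plumbing for one brick of a published, surveyed 2021 theorem; it
discharges nothing by itself (`DDS2021_thm_3_2`, `DDS2021_thm_5_1` OPEN by name); VP ≠ VNP is
NOT proved and nothing here bears on it.

## References

* [DuttaDwivediSaxena2022] P. Dutta, P. Dwivedi, N. Saxena, *Demystifying the border of depth-3
  algebraic circuits*, Proc. 62nd FOCS (2021), IEEE 2022, 92–103; full version §3, proof of
  Thm. 3.2: the map `Φ` and `R_0` (p0028 L751–755), Divide/Derive (3.1)–(3.2) (p0029 L765–767,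
  p0030 L808–812), induction hypotheses (p0030 L799–805), Claim 3.3 proof (p0027 L724–744),
  eq. (3.3) (p0032 L854–862), Claim 3.6 (p0033 L873–890); Lemma 2.14 (p0021 L571–576).
* [Eisenbud1995] D. Eisenbud, *Commutative Algebra with a View Toward Algebraic Geometry*, GTM
  150, Springer 1995, §16.2 (derivations extend uniquely to localizations) — attribution for §3.
-/

noncomputable section

open MvPolynomial
open Finset.HasAntidiagonal (antidiagonal mem_antidiagonal)
open scoped BigOperators

namespace Literature.Computability.AlgebraicComplexity

namespace DDS2021

/-! ## §1 Exponent sets by total degree; homogeneous parts and jets of power series -/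

section Graded

variable {σ : Type*} [Fintype σ] [DecidableEq σ] {R : Type*} [CommSemiring R]

/-- The exponents `d : σ →₀ ℕ` of total degree exactly `c` (a finite set since `σ` is finite).
[cite: DuttaDwivediSaxena2022, §3 proof of Thm. 3.2, Φ and R_0 (full version p0028 L751–755)] -/
def degEq (σ : Type*) [Fintype σ] [DecidableEq σ] (c : ℕ) : Finset (σ →₀ ℕ) :=
  (Finset.univ : Finset σ).finsuppAntidiag c

/-- Membership in `degEq`: total degree `= c`.
[cite: DuttaDwivediSaxena2022, §3 proof of Thm. 3.2, Φ and R_0 (full version p0028 L751–755)] -/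
@[simp] theorem mem_degEq {c : ℕ} {d : σ →₀ ℕ} : d ∈ degEq σ c ↔ d.degree = c := by
  rw [degEq, Finset.mem_finsuppAntidiag, Finsupp.degree_eq_sum]
  simp

/-- The exponents of total degree `< N`.
[cite: DuttaDwivediSaxena2022, §3 proof of Thm. 3.2, Φ and R_0 (full version p0028 L751–755)] -/
def degLT (σ : Type*) [Fintype σ] [DecidableEq σ] (N : ℕ) : Finset (σ →₀ ℕ) :=
  (Finset.range N).biUnion (degEq σ)

/-- Membership in `degLT`: total degree `< N`.
[cite: DuttaDwivediSaxena2022, §3 proof of Thm. 3.2, Φ and R_0 (full version p0028 L751–755)] -/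
@[simp] theorem mem_degLT {N : ℕ} {d : σ →₀ ℕ} : d ∈ degLT σ N ↔ d.degree < N := by
  simp [degLT]

/-- `degLT σ N` is a lower set (divisors of a monomial of degree `< N` have degree `< N`).
[cite: DuttaDwivediSaxena2022, §3 proof of Thm. 3.2, Φ and R_0 (full version p0028 L751–755)] -/
theorem isLowerSet_degLT (N : ℕ) : IsLowerSet ((degLT σ N : Finset (σ →₀ ℕ)) : Set (σ →₀ ℕ)) := by
  intro a b hba ha
  rw [Finset.mem_coe, mem_degLT] at ha ⊢
  obtain ⟨c, rfl⟩ := exists_add_of_le hba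
  rw [map_add] at ha
  exact lt_of_le_of_lt (Nat.le_add_right _ _) ha

/-- **Homogeneous part of degree `c` of a power series, as a polynomial**: the finitely many
monomials of total degree `c` with their coefficients (the graded piece `[z^c]Φ(·)` of DDS21 §3
read in the graded frame: the auxiliary variable `z` of the map `Φ : x_i ↦ z·x_i + α_i`
(full version p0028 L751–754) tags the total degree in `x` after the shift by `α`).
[cite: DuttaDwivediSaxena2022, §3 proof of Thm. 3.2, the map Φ (full version p0028 L751–755)] -/
def hpart (c : ℕ) : MvPowerSeries σ R →ₗ[R] MvPolynomial σ R :=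
  MvPowerSeries.truncFinset R (degEq σ c)

/-- Coefficients of the homogeneous part.
[cite: DuttaDwivediSaxena2022, §3 proof of Thm. 3.2, Φ and R_0 (full version p0028 L751–755)] -/
theorem coeff_hpart (c : ℕ) (φ : MvPowerSeries σ R) (d : σ →₀ ℕ) :
    coeff d (hpart c φ) = if d.degree = c then MvPowerSeries.coeff d φ else 0 := by
  rw [hpart, MvPowerSeries.coeff_truncFinset]
  simp only [mem_degEq]

/-- On polynomials `hpart c` is Mathlib's `homogeneousComponent c`.
[cite: DuttaDwivediSaxena2022, §3 proof of Thm. 3.2, Φ and R_0 (full version p0028 L751–755)] -/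
theorem hpart_coe (c : ℕ) (p : MvPolynomial σ R) :
    hpart c (p : MvPowerSeries σ R) = homogeneousComponent c p := by
  ext d
  rw [coeff_hpart, coeff_homogeneousComponent, MvPolynomial.coeff_coe]

/-- The homogeneous part, read back as a power series, is Mathlib's
`MvPowerSeries.homogeneousComponent`.
[cite: DuttaDwivediSaxena2022, §3 proof of Thm. 3.2, Φ and R_0 (full version p0028 L751–755)] -/
theorem coe_hpart (c : ℕ) (φ : MvPowerSeries σ R) :
    ((hpart c φ : MvPolynomial σ R) : MvPowerSeries σ R) = MvPowerSeries.homogeneousComponent c φ := by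
  ext d
  rw [MvPolynomial.coeff_coe, coeff_hpart, MvPowerSeries.coeff_homogeneousComponent]

/-- `hpart c' (hpart c φ)` is `hpart c φ` for `c' = c` and `0` otherwise.
[cite: DuttaDwivediSaxena2022, §3 proof of Thm. 3.2, Φ and R_0 (full version p0028 L751–755)] -/
theorem hpart_coe_hpart (c c' : ℕ) (φ : MvPowerSeries σ R) :
    hpart c' ((hpart c φ : MvPolynomial σ R) : MvPowerSeries σ R) = if c' = c then hpart c φ else 0 := by
  ext d
  simp only [coeff_hpart, MvPolynomial.coeff_coe]
  by_cases h : c' = c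
  · subst h
    simp only [if_true, coeff_hpart]
    split_ifs <;> rfl
  · rw [if_neg h, coeff_zero]
    split_ifs with h1 h2
    · exact absurd (h1.symm.trans h2) h
    · rfl
    · rfl

/-- `hpart c φ` is homogeneous of degree `c`.
[cite: DuttaDwivediSaxena2022, §3 proof of Thm. 3.2, Φ and R_0 (full version p0028 L751–755)] -/
theorem isHomogeneous_hpart (c : ℕ) (φ : MvPowerSeries σ R) : (hpart c φ).IsHomogeneous c := by
  have h : homogeneousComponent c (hpart c φ) = hpart c φ := by
    rw [← hpart_coe, hpart_coe_hpart, if_pos rfl]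
  rw [← h]
  exact homogeneousComponent_isHomogeneous c _

/-- Homogeneous parts below the order vanish.
[cite: DuttaDwivediSaxena2022, §3 proof of Thm. 3.2, Φ and R_0 (full version p0028 L751–755)] -/
theorem hpart_eq_zero_of_lt_order {c : ℕ} {φ : MvPowerSeries σ R} (h : (c : ℕ∞) < φ.order) :
    hpart c φ = 0 := by
  ext d
  rw [coeff_hpart, coeff_zero]
  split_ifs with hd
  · exact MvPowerSeries.coeff_of_lt_order (by rw [hd]; exact h)
  · rfl

/-- `hpart 0 φ` is the constant coefficient.
[cite: DuttaDwivediSaxena2022, §3 proof of Thm. 3.2, Φ and R_0 (full version p0028 L751–755)] -/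
theorem hpart_zero (φ : MvPowerSeries σ R) : hpart 0 φ = C (MvPowerSeries.constantCoeff φ) := by
  ext d
  simp only [coeff_hpart, coeff_C]
  by_cases hd : d = 0
  · subst hd; simp
  · rw [if_neg (Ne.symm hd), if_neg]
    rwa [Finsupp.degree_eq_zero_iff]

/-- `hpart c 1`.
[cite: DuttaDwivediSaxena2022, §3 proof of Thm. 3.2, Φ and R_0 (full version p0028 L751–755)] -/
theorem hpart_one (c : ℕ) : hpart c (1 : MvPowerSeries σ R) = if c = 0 then 1 else 0 := by
  have h := hpart_coe (R := R) c (1 : MvPolynomial σ R)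
  rw [MvPolynomial.coe_one] at h
  rw [h, homogeneousComponent_of_mem (isHomogeneous_one σ R)]

/-- `hpart c (C a)`.
[cite: DuttaDwivediSaxena2022, §3 proof of Thm. 3.2, Φ and R_0 (full version p0028 L751–755)] -/
theorem hpart_C (c : ℕ) (a : R) :
    hpart c (MvPowerSeries.C a : MvPowerSeries σ R) = if c = 0 then C a else 0 := by
  have h := hpart_coe (R := R) c (C a : MvPolynomial σ R)
  rw [MvPolynomial.coe_C] at h
  rw [h, homogeneousComponent_of_mem (isHomogeneous_C σ a)]

/-- **Cauchy product by total degree**: the degree-`c` part of a product of power series is the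
convolution of the homogeneous parts, `(φψ)_c = ∑_{i+j=c} φ_i ψ_j`.
[cite: DuttaDwivediSaxena2022, §3 proof of Thm. 3.2, Φ and R_0 (full version p0028 L751–755)] -/
theorem hpart_mul (c : ℕ) (φ ψ : MvPowerSeries σ R) :
    hpart c (φ * ψ) = ∑ ij ∈ antidiagonal c, hpart ij.1 φ * hpart ij.2 ψ := by
  ext d
  rw [coeff_hpart, coeff_sum, MvPowerSeries.coeff_mul]
  simp_rw [coeff_mul, coeff_hpart]
  rw [Finset.sum_comm]
  split_ifs with hd
  · refine Finset.sum_congr rfl fun x hx => ?_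
    have hx' : x.1 + x.2 = d := by simpa using hx
    have hdeg : x.1.degree + x.2.degree = c := by rw [← map_add, hx', hd]
    rw [Finset.sum_eq_single_of_mem (x.1.degree, x.2.degree) (mem_antidiagonal.2 hdeg)]
    · rw [if_pos rfl, if_pos rfl]
    · rintro ⟨i, j⟩ hij hne
      by_cases h1 : x.1.degree = i
      · by_cases h2 : x.2.degree = j
        · exact absurd (Prod.ext h1 h2).symm hne
        · rw [if_neg h2, mul_zero]
      · rw [if_neg h1, zero_mul]
  · refine (Finset.sum_eq_zero fun x hx => Finset.sum_eq_zero fun ij hij => ?_).symm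
    have hx' : x.1 + x.2 = d := by simpa using hx
    have hij' : ij.1 + ij.2 = c := mem_antidiagonal.1 hij
    by_cases h1 : x.1.degree = ij.1
    · by_cases h2 : x.2.degree = ij.2
      · exfalso; apply hd
        rw [← hx', map_add, h1, h2, hij']
      · rw [if_neg h2, mul_zero]
    · rw [if_neg h1, zero_mul]

/-- **`N`-jet of a power series**: its truncation below total degree `N`, as a polynomial (the
graded reading of "mod `z^N`", DDS21 §3: "`R_0 := F[z]/⟨z^d⟩`", full version p0028 L755).
[cite: DuttaDwivediSaxena2022, §3 proof of Thm. 3.2 (full version p0028 L755)] -/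
def jet (N : ℕ) : MvPowerSeries σ R →ₗ[R] MvPolynomial σ R :=
  MvPowerSeries.truncFinset R (degLT σ N)

/-- Coefficients of the jet.
[cite: DuttaDwivediSaxena2022, §3 proof of Thm. 3.2, Φ and R_0 (full version p0028 L751–755)] -/
theorem coeff_jet (N : ℕ) (φ : MvPowerSeries σ R) (d : σ →₀ ℕ) :
    coeff d (jet N φ) = if d.degree < N then MvPowerSeries.coeff d φ else 0 := by
  rw [jet, MvPowerSeries.coeff_truncFinset]
  simp only [mem_degLT]

/-- The jet is the sum of the homogeneous parts below `N`.
[cite: DuttaDwivediSaxena2022, §3 proof of Thm. 3.2, Φ and R_0 (full version p0028 L751–755)] -/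
theorem jet_eq_sum_hpart (N : ℕ) (φ : MvPowerSeries σ R) :
    jet N φ = ∑ c ∈ Finset.range N, hpart c φ := by
  ext d
  rw [coeff_jet, coeff_sum]
  simp_rw [coeff_hpart]
  rw [Finset.sum_ite_eq]
  simp only [Finset.mem_range]

/-- On polynomials the jet is the degree truncation `∑_{c<N} homogeneousComponent c p`.
[cite: DuttaDwivediSaxena2022, §3 proof of Thm. 3.2, Φ and R_0 (full version p0028 L751–755)] -/
theorem jet_coe (N : ℕ) (p : MvPolynomial σ R) :
    jet N (p : MvPowerSeries σ R) = ∑ c ∈ Finset.range N, homogeneousComponent c p := by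
  rw [jet_eq_sum_hpart]
  simp_rw [hpart_coe]

/-- Homogeneous parts of the jet.
[cite: DuttaDwivediSaxena2022, §3 proof of Thm. 3.2, Φ and R_0 (full version p0028 L751–755)] -/
theorem hpart_coe_jet (N c : ℕ) (φ : MvPowerSeries σ R) :
    hpart c ((jet N φ : MvPolynomial σ R) : MvPowerSeries σ R) = if c < N then hpart c φ else 0 := by
  ext d
  simp only [coeff_hpart, MvPolynomial.coeff_coe, coeff_jet]
  by_cases h : c < N
  · simp only [if_pos h, coeff_hpart]
    split_ifs with h1 h2
    · rfl
    · exact absurd (h1 ▸ h) h2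
    · rfl
  · rw [if_neg h, coeff_zero]
    split_ifs with h1 h2
    · exact absurd (h1 ▸ h2) h
    · rfl
    · rfl

/-- A polynomial of total degree `< N` is its own `N`-jet.
[cite: DuttaDwivediSaxena2022, §3 proof of Thm. 3.2, Φ and R_0 (full version p0028 L751–755)] -/
theorem jet_coe_eq_self {N : ℕ} {p : MvPolynomial σ R} (hp : p.totalDegree < N) :
    jet N (p : MvPowerSeries σ R) = p := by
  ext d
  rw [coeff_jet, MvPolynomial.coeff_coe]
  split_ifs with hd
  · rfl
  · symm
    by_contra h
    refine hd (lt_of_le_of_lt ?_ hp)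
    have hmem : d ∈ p.support := by rwa [mem_support_iff]
    simpa [Finsupp.degree_apply, Finsupp.sum] using le_totalDegree hmem

/-- **Jets are multiplicative**: the `N`-jet of a product only depends on the `N`-jets of the
factors.
[cite: DuttaDwivediSaxena2022, §3 proof of Thm. 3.2, Φ and R_0 (full version p0028 L751–755)] -/
theorem jet_mul_jet (N : ℕ) (φ ψ : MvPowerSeries σ R) :
    jet N ((jet N φ * jet N ψ : MvPolynomial σ R) : MvPowerSeries σ R) = jet N (φ * ψ) := by
  ext d
  rw [coeff_jet, coeff_jet, MvPolynomial.coeff_coe]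
  split_ifs with hd
  · exact MvPowerSeries.coeff_truncFinset_mul_truncFinset_eq_coeff_mul (isLowerSet_degLT N) φ ψ
      (mem_degLT.2 hd)
  · rfl

end Graded

/-! ## §2 The Euler derivation `E = ∑_i x_i ∂_i`

In the graded frame the operator `z∂_z` of the DiDIL step (DDS21 §3, "Derive", full version
p0029 L766–767 and p0030 L808–812: `∂_z(·/T̃)`) is the Euler derivation, which multiplies the
degree-`u` homogeneous part by `u`. -/

section Euler

variable (σ : Type*) (R : Type*) [CommSemiring R]

/-- **The Euler derivation** `E` of `R[x_σ]`: the `R`-derivation with `E(x_i) = x_i`, i.e.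
`E = ∑_i x_i · ∂/∂x_i`; it scales the homogeneous part of degree `u` by `u` (the graded form of
DDS21's `z∂_z` after the degree-tagging map `Φ`). Packaged as a `Derivation` over any
commutative semiring and any index type (no finiteness) so that it extends to `K(x)` (§3); on
finitely many variables over a ring it IS the tree's weight operator
`Literature.RingTheory.MvPolynomial.weightOp 1` (`euler_eq_weightOp_one`) and Mathlib's
`∑ i, X i * pderiv i` (`euler_eq_sum_X_mul_pderiv`) — cited, not restated.
[cite: DuttaDwivediSaxena2022, §3 proof of Thm. 3.2, "Derive" (full version p0029 L766–767, p0030 L808–812)] -/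
def euler : Derivation R (MvPolynomial σ R) (MvPolynomial σ R) :=
  mkDerivation R (X : σ → MvPolynomial σ R)

variable {σ R}

/-- `E(x_i) = x_i`.
[cite: DuttaDwivediSaxena2022, §3 proof of Thm. 3.2, Derive (3.1)–(3.2) (full version p0029 L766–767, p0030 L808–812)] -/
@[simp] theorem euler_X (i : σ) : euler σ R (X i) = X i :=
  mkDerivation_X _ _ i

/-- `E` kills constants.
[cite: DuttaDwivediSaxena2022, §3 proof of Thm. 3.2, Derive (3.1)–(3.2) (full version p0029 L766–767, p0030 L808–812)] -/
@[simp] theorem euler_C (a : R) : euler σ R (C a) = 0 :=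
  derivation_C _ a

/-- `E` on a monomial: multiplication by its total degree.
[cite: DuttaDwivediSaxena2022, §3 proof of Thm. 3.2, Derive (3.1)–(3.2) (full version p0029 L766–767, p0030 L808–812)] -/
theorem euler_monomial (s : σ →₀ ℕ) (r : R) :
    euler σ R (monomial s r) = monomial s ((s.degree : R) * r) := by
  rw [euler, mkDerivation_monomial, Finsupp.sum]
  have h : ∀ i ∈ s.support,
      (monomial (s - Finsupp.single i 1) ((s i : ℕ) : R) • X i : MvPolynomial σ R) =
        monomial s (s i : R) := by
    intro i hi
    rw [smul_eq_mul, X, monomial_mul, mul_one, tsub_add_cancel_of_le]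
    exact Finsupp.single_le_iff.2 (Nat.one_le_iff_ne_zero.2 (Finsupp.mem_support_iff.1 hi))
  rw [Finset.sum_congr rfl h, ← map_sum, ← Nat.cast_sum, ← Finsupp.degree_apply, smul_monomial,
    smul_eq_mul, mul_comm]

/-- Coefficients of `E p`: `[x^d] E p = |d| · [x^d] p`.
[cite: DuttaDwivediSaxena2022, §3 proof of Thm. 3.2, Derive (3.1)–(3.2) (full version p0029 L766–767, p0030 L808–812)] -/
theorem coeff_euler (d : σ →₀ ℕ) (p : MvPolynomial σ R) :
    coeff d (euler σ R p) = (d.degree : R) * coeff d p := by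
  classical
  induction p using MvPolynomial.induction_on' with
  | monomial s a =>
    rw [euler_monomial, coeff_monomial, coeff_monomial]
    split_ifs with h
    · rw [h]
    · rw [mul_zero]
  | add p q hp hq => rw [map_add, coeff_add, coeff_add, hp, hq, mul_add]

/-- `E` acts on the degree-`c` homogeneous component as multiplication by `c`.
[cite: DuttaDwivediSaxena2022, §3 proof of Thm. 3.2, Derive (3.1)–(3.2) (full version p0029 L766–767, p0030 L808–812)] -/
theorem homogeneousComponent_euler (c : ℕ) (p : MvPolynomial σ R) :
    homogeneousComponent c (euler σ R p) = (c : R) • homogeneousComponent c p := by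
  ext d
  rw [coeff_homogeneousComponent, coeff_smul, coeff_homogeneousComponent, coeff_euler]
  split_ifs with h
  · rw [h, smul_eq_mul]
  · rw [smul_zero]

/-- `E` of a homogeneous component.
[cite: DuttaDwivediSaxena2022, §3 proof of Thm. 3.2, Derive (3.1)–(3.2) (full version p0029 L766–767, p0030 L808–812)] -/
theorem euler_homogeneousComponent (c : ℕ) (p : MvPolynomial σ R) :
    euler σ R (homogeneousComponent c p) = (c : R) • homogeneousComponent c p := by
  ext d
  rw [coeff_euler, coeff_smul, coeff_homogeneousComponent]
  split_ifs with h
  · rw [h, smul_eq_mul]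
  · rw [mul_zero, smul_zero]

/-- **Euler's theorem**: `E φ = c · φ` for `φ` homogeneous of degree `c`.
[cite: DuttaDwivediSaxena2022, §3 proof of Thm. 3.2, Derive (3.1)–(3.2) (full version p0029 L766–767, p0030 L808–812)] -/
theorem euler_of_isHomogeneous {c : ℕ} {φ : MvPolynomial σ R} (h : φ.IsHomogeneous c) :
    euler σ R φ = (c : R) • φ := by
  have hφ : homogeneousComponent c φ = φ := by
    rw [homogeneousComponent_of_mem h, if_pos rfl]
  rw [← hφ, euler_homogeneousComponent, hφ]

/-- `E = ∑_i x_i ∂_i` (finitely many variables).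
[cite: DuttaDwivediSaxena2022, §3 proof of Thm. 3.2, Derive (3.1)–(3.2) (full version p0029 L766–767, p0030 L808–812)] -/
theorem euler_eq_sum_X_mul_pderiv [Fintype σ] (p : MvPolynomial σ R) :
    euler σ R p = ∑ i, X i * pderiv i p := by
  classical
  induction p using MvPolynomial.induction_on' with
  | monomial s a =>
    simp_rw [X_mul_pderiv_monomial]
    rw [← Finset.sum_smul, ← Finsupp.degree_eq_sum, euler_monomial, ← nsmul_eq_mul, map_nsmul]
  | add p q hp hq => simp_rw [map_add, hp, hq, mul_add, Finset.sum_add_distrib]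

/-- Leibniz rule for `E`, multiplicative form.
[cite: DuttaDwivediSaxena2022, §3 proof of Thm. 3.2, Derive (3.1)–(3.2) (full version p0029 L766–767, p0030 L808–812)] -/
theorem euler_mul (p q : MvPolynomial σ R) :
    euler σ R (p * q) = euler σ R p * q + p * euler σ R q := by
  rw [(euler σ R).leibniz, smul_eq_mul, smul_eq_mul, add_comm, mul_comm (euler σ R p)]

/-- `E` commutes with maps of the coefficient ring (e.g. `F ↪ F(ε)`, reduction modulo `ε` on
`F[ε]`-coefficients).
[cite: DuttaDwivediSaxena2022, §3 proof of Thm. 3.2, Derive (3.1)–(3.2) (full version p0029 L766–767, p0030 L808–812)] -/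
theorem euler_map {S : Type*} [CommSemiring S] (f : R →+* S) (p : MvPolynomial σ R) :
    euler σ S (map f p) = map f (euler σ R p) := by
  ext d
  rw [coeff_euler, coeff_map, coeff_map, coeff_euler, map_mul, map_natCast]

/-- `E` is the tree's weight operator with all weights `1` (finitely many variables, ring
coefficients): `Literature.RingTheory.MvPolynomial.weightOp 1`.
[cite: DuttaDwivediSaxena2022, §3 proof of Thm. 3.2, Derive (3.1)–(3.2) (full version p0029 L766–767, p0030 L808–812)] -/
theorem euler_eq_weightOp_one [Fintype σ] {R : Type*} [CommRing R] (p : MvPolynomial σ R) :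
    euler σ R p = Literature.RingTheory.MvPolynomial.weightOp (1 : σ → ℤ) p := by
  ext d
  rw [coeff_euler, Literature.RingTheory.MvPolynomial.coeff_weightOp,
    Literature.RingTheory.MvPolynomial.wt_one, Int.cast_natCast]

/-- In characteristic zero `E p = 0` iff `p` is constant.
[cite: DuttaDwivediSaxena2022, §3 proof of Thm. 3.2, Derive (3.1)–(3.2) (full version p0029 L766–767, p0030 L808–812)] -/
theorem euler_eq_zero_iff [NoZeroDivisors R] [CharZero R] (p : MvPolynomial σ R) :
    euler σ R p = 0 ↔ p = C (coeff 0 p) := by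
  classical
  constructor
  · intro h
    ext d
    rw [coeff_C]
    split_ifs with hd
    · rw [← hd]
    · have h1 := congr_arg (coeff d) h
      rw [coeff_euler, coeff_zero, mul_eq_zero] at h1
      rcases h1 with h1 | h1
      · exfalso
        rw [Nat.cast_eq_zero, Finsupp.degree_eq_zero_iff] at h1
        exact hd (h1 ▸ rfl)
      · exact h1
  · intro h
    rw [h, euler_C]

variable (σ R)

/-- The Euler operator on power series, as a bare function: scale the coefficient of `x^d` by
`|d|`.
[cite: DuttaDwivediSaxena2022, §3 proof of Thm. 3.2, Derive (3.1)–(3.2) (full version p0029 L766–767, p0030 L808–812)] -/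
def eulerFun (φ : MvPowerSeries σ R) : MvPowerSeries σ R := fun d => (d.degree : R) * φ d

variable {σ R}

/-- Coefficients of `eulerFun`.
[cite: DuttaDwivediSaxena2022, §3 proof of Thm. 3.2, Derive (3.1)–(3.2) (full version p0029 L766–767, p0030 L808–812)] -/
theorem coeff_eulerFun (d : σ →₀ ℕ) (φ : MvPowerSeries σ R) :
    MvPowerSeries.coeff d (eulerFun σ R φ) = (d.degree : R) * MvPowerSeries.coeff d φ := rfl

variable (σ R)

/-- **The Euler derivation of the power series ring** `R[[x_σ]]` (coefficientwise `|d| · [x^d]`);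
it restricts to `euler` on polynomials and acts on the degree-`c` homogeneous part as
multiplication by `c`.
[cite: DuttaDwivediSaxena2022, §3 proof of Thm. 3.2, Derive (3.1)–(3.2) (full version p0029 L766–767, p0030 L808–812)] -/
def eulerSeries : Derivation R (MvPowerSeries σ R) (MvPowerSeries σ R) where
  toFun := eulerFun σ R
  map_add' φ ψ := by
    ext d
    simp only [coeff_eulerFun, map_add, mul_add]
  map_smul' a φ := by
    ext d
    simp only [coeff_eulerFun, map_smul, smul_eq_mul, RingHom.id_apply, mul_left_comm]
  map_one_eq_zero' := by
    classical
    ext d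
    show MvPowerSeries.coeff d (eulerFun σ R 1) = _
    rw [coeff_eulerFun, MvPowerSeries.coeff_one, map_zero]
    split_ifs with h
    · rw [h, map_zero, Nat.cast_zero, zero_mul]
    · rw [mul_zero]
  leibniz' φ ψ := by
    classical
    ext d
    show MvPowerSeries.coeff d (eulerFun σ R (φ * ψ)) =
      MvPowerSeries.coeff d (φ • eulerFun σ R ψ + ψ • eulerFun σ R φ)
    rw [coeff_eulerFun, smul_eq_mul, smul_eq_mul, mul_comm ψ, map_add, MvPowerSeries.coeff_mul,
      MvPowerSeries.coeff_mul, MvPowerSeries.coeff_mul, Finset.mul_sum, ← Finset.sum_add_distrib]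
    refine Finset.sum_congr rfl fun x hx => ?_
    rw [coeff_eulerFun, coeff_eulerFun, ← (mem_antidiagonal.1 hx : x.1 + x.2 = d), map_add,
      Nat.cast_add]
    ring

variable {σ R}

/-- Coefficients of `E φ`.
[cite: DuttaDwivediSaxena2022, §3 proof of Thm. 3.2, Derive (3.1)–(3.2) (full version p0029 L766–767, p0030 L808–812)] -/
@[simp] theorem coeff_eulerSeries (d : σ →₀ ℕ) (φ : MvPowerSeries σ R) :
    MvPowerSeries.coeff d (eulerSeries σ R φ) = (d.degree : R) * MvPowerSeries.coeff d φ := rfl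

/-- `E` on power series restricts to `E` on polynomials.
[cite: DuttaDwivediSaxena2022, §3 proof of Thm. 3.2, Derive (3.1)–(3.2) (full version p0029 L766–767, p0030 L808–812)] -/
theorem eulerSeries_coe (p : MvPolynomial σ R) :
    eulerSeries σ R (p : MvPowerSeries σ R) = (euler σ R p : MvPolynomial σ R) := by
  ext d
  rw [coeff_eulerSeries, MvPolynomial.coeff_coe, MvPolynomial.coeff_coe, coeff_euler]

/-- `E` multiplies the degree-`c` part by `c`.
[cite: DuttaDwivediSaxena2022, §3 proof of Thm. 3.2, Derive (3.1)–(3.2) (full version p0029 L766–767, p0030 L808–812)] -/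
theorem hpart_eulerSeries [Fintype σ] [DecidableEq σ] (c : ℕ) (φ : MvPowerSeries σ R) :
    hpart c (eulerSeries σ R φ) = (c : R) • hpart c φ := by
  ext d
  rw [coeff_hpart, coeff_smul, coeff_hpart, coeff_eulerSeries]
  split_ifs with h
  · rw [h, smul_eq_mul]
  · rw [smul_zero]

/-- `E` of the constant series.
[cite: DuttaDwivediSaxena2022, §3 proof of Thm. 3.2, Derive (3.1)–(3.2) (full version p0029 L766–767, p0030 L808–812)] -/
theorem eulerSeries_C (a : R) : eulerSeries σ R (MvPowerSeries.C a) = 0 := by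
  rw [← MvPolynomial.coe_C, eulerSeries_coe, euler_C, MvPolynomial.coe_zero]

/-- **Quotient rule for a unit denominator** (over a field): `E(φ ψ⁻¹) = (Eφ·ψ − φ·Eψ)·ψ⁻¹·ψ⁻¹`
when `ψ(0) ≠ 0`.
[cite: DuttaDwivediSaxena2022, §3 proof of Thm. 3.2, Derive (3.1)–(3.2) (full version p0029 L766–767, p0030 L808–812)] -/
theorem eulerSeries_mul_inv {k : Type*} [Field k] (φ ψ : MvPowerSeries σ k)
    (hψ : MvPowerSeries.constantCoeff ψ ≠ 0) :
    eulerSeries σ k (φ * ψ⁻¹) =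
      (eulerSeries σ k φ * ψ - φ * eulerSeries σ k ψ) * ψ⁻¹ * ψ⁻¹ := by
  rw [(eulerSeries σ k).leibniz,
    (eulerSeries σ k).leibniz_of_mul_eq_one (MvPowerSeries.inv_mul_cancel ψ hψ), smul_eq_mul,
    smul_eq_mul, smul_eq_mul]
  have h1 : ψ * ψ⁻¹ = 1 := MvPowerSeries.mul_inv_cancel ψ hψ
  linear_combination (-(ψ⁻¹ * eulerSeries σ k φ)) * h1

end Euler

/-! ## §3 Extending a derivation to a localization (the fraction field `K(x)`)

The exact DiDIL objects live in `K(x) = Frac K[x]` (memo R1: `T_{i,j+1} := E(T_{i,j}/T̃_{m,j})`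
exactly); `E` extends uniquely to the fraction field by the quotient rule. The extension is
built through the dual numbers: `a ↦ (a, D a)` is a ring map `A → L[ε]/(ε²)` sending
denominators to units, so it factors through the localization. -/

section LocDeriv

variable {R : Type*} [CommSemiring R] {A : Type*} [CommRing A] [Algebra R A]
  {L : Type*} [CommRing L] [Algebra A L] (D : Derivation R A A)

/-- The ring map `a ↦ (a, D a) : A → L[ε]/(ε²)` (dual numbers over the localization) attached
to a derivation `D` of `A`.
[cite: Eisenbud1995, §16.2 Prop. 16.9 (derivations and differentials localize)] -/
def dualHom : A →+* TrivSqZeroExt L L where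
  toFun a := TrivSqZeroExt.inl (algebraMap A L a) + TrivSqZeroExt.inr (algebraMap A L (D a))
  map_one' := by
    ext
    · simp only [map_one, TrivSqZeroExt.fst_add, TrivSqZeroExt.fst_inl, TrivSqZeroExt.fst_inr,
        add_zero, TrivSqZeroExt.fst_one]
    · simp only [D.map_one_eq_zero, map_zero, TrivSqZeroExt.snd_add, TrivSqZeroExt.snd_inl,
        TrivSqZeroExt.snd_inr, add_zero, TrivSqZeroExt.snd_one]
  map_mul' a b := by
    ext
    · simp only [map_mul, TrivSqZeroExt.fst_add, TrivSqZeroExt.fst_inl, TrivSqZeroExt.fst_inr,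
        add_zero, TrivSqZeroExt.fst_mul]
    · simp only [D.leibniz, map_add, map_mul, smul_eq_mul, TrivSqZeroExt.snd_add,
        TrivSqZeroExt.snd_mul, TrivSqZeroExt.fst_add, TrivSqZeroExt.fst_inl, TrivSqZeroExt.fst_inr,
        TrivSqZeroExt.snd_inl, TrivSqZeroExt.snd_inr, add_zero, zero_add, op_smul_eq_mul]
      ring
  map_zero' := by
    ext
    · simp only [map_zero, TrivSqZeroExt.fst_add, TrivSqZeroExt.fst_inl, TrivSqZeroExt.fst_inr,
        add_zero, TrivSqZeroExt.fst_zero]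
    · simp only [map_zero, TrivSqZeroExt.snd_add, TrivSqZeroExt.snd_inl, TrivSqZeroExt.snd_inr,
        add_zero, TrivSqZeroExt.snd_zero]
  map_add' a b := by
    ext
    · simp only [map_add, TrivSqZeroExt.fst_add, TrivSqZeroExt.fst_inl, TrivSqZeroExt.fst_inr,
        add_zero]
    · simp only [map_add, TrivSqZeroExt.snd_add, TrivSqZeroExt.snd_inl, TrivSqZeroExt.snd_inr,
        zero_add]

/-- Components of `dualHom`.
[cite: Eisenbud1995, §16.2 Prop. 16.9 (derivations and differentials localize)] -/
@[simp] theorem fst_dualHom (a : A) : (dualHom (L := L) D a).fst = algebraMap A L a := by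
  show (TrivSqZeroExt.inl (algebraMap A L a) + TrivSqZeroExt.inr (algebraMap A L (D a)) :
    TrivSqZeroExt L L).fst = _
  simp only [TrivSqZeroExt.fst_add, TrivSqZeroExt.fst_inl, TrivSqZeroExt.fst_inr, add_zero]

/-- Components of `dualHom`.
[cite: Eisenbud1995, §16.2 Prop. 16.9 (derivations and differentials localize)] -/
@[simp] theorem snd_dualHom (a : A) : (dualHom (L := L) D a).snd = algebraMap A L (D a) := by
  show (TrivSqZeroExt.inl (algebraMap A L a) + TrivSqZeroExt.inr (algebraMap A L (D a)) :
    TrivSqZeroExt L L).snd = _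
  simp only [TrivSqZeroExt.snd_add, TrivSqZeroExt.snd_inl, TrivSqZeroExt.snd_inr, zero_add]

variable (M : Submonoid A) [IsLocalization M L]

/-- Denominators go to units of the dual numbers.
[cite: Eisenbud1995, §16.2 Prop. 16.9 (derivations and differentials localize)] -/
theorem isUnit_dualHom (m : M) : IsUnit (dualHom (L := L) D m) := by
  rw [TrivSqZeroExt.isUnit_iff_isUnit_fst, fst_dualHom]
  exact IsLocalization.map_units L m

/-- The factorisation `L → L[ε]/(ε²)` of `dualHom` through the localization.
[cite: Eisenbud1995, §16.2 Prop. 16.9 (derivations and differentials localize)] -/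
def locDualHom : L →+* TrivSqZeroExt L L :=
  IsLocalization.lift (M := M) (g := dualHom (L := L) D) (isUnit_dualHom D M)

/-- `locDualHom` extends `dualHom`.
[cite: Eisenbud1995, §16.2 Prop. 16.9 (derivations and differentials localize)] -/
theorem locDualHom_algebraMap (a : A) :
    locDualHom (L := L) D M (algebraMap A L a) = dualHom (L := L) D a :=
  IsLocalization.lift_eq _ a

/-- The first component of `locDualHom` is the identity.
[cite: Eisenbud1995, §16.2 Prop. 16.9 (derivations and differentials localize)] -/
theorem fst_locDualHom (x : L) : (locDualHom (L := L) D M x).fst = x := by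
  have h : (TrivSqZeroExt.fstHom L L L).toRingHom.comp (locDualHom (L := L) D M) =
      RingHom.id L := by
    refine IsLocalization.ringHom_ext M ?_
    ext a
    simp [locDualHom_algebraMap]
  exact RingHom.congr_fun h x

variable [Algebra R L]

include M in
omit [Algebra R A] in
/-- **Uniqueness**: a derivation of the localization is determined by its values on `A`.
[cite: Eisenbud1995, §16.2 Prop. 16.9 (derivations and differentials localize)] -/
theorem derivation_eq_of_algebraMap {D₁ D₂ : Derivation R L L}
    (h : ∀ a : A, D₁ (algebraMap A L a) = D₂ (algebraMap A L a)) : D₁ = D₂ := by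
  refine Derivation.ext fun x => ?_
  obtain ⟨a, m, rfl⟩ := IsLocalization.exists_mk'_eq M x
  have hu : IsUnit (algebraMap A L m) := IsLocalization.map_units L m
  have key : ∀ D' : Derivation R L L, D' (IsLocalization.mk' L a m) * algebraMap A L m =
      D' (algebraMap A L a) - IsLocalization.mk' L a m * D' (algebraMap A L m) := by
    intro D'
    have e := congr_arg D' (IsLocalization.mk'_spec L a m)
    rw [D'.leibniz, smul_eq_mul, smul_eq_mul] at e
    linear_combination e
  have h1 := key D₁
  rw [h, h, ← key D₂] at h1
  exact hu.mul_left_injective h1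

variable [IsScalarTower R A L]

/-- **Extension of a derivation to a localization** (in particular to the fraction field): the
unique derivation `D_L` of `L = M⁻¹A` with `D_L(a/1) = (D a)/1`; it obeys the quotient rule.
[cite: Eisenbud1995, §16.2 Prop. 16.9 (derivations and differentials localize)] -/
def locDeriv : Derivation R L L where
  toFun x := (locDualHom (L := L) D M x).snd
  map_add' x y := by simp
  map_smul' r x := by
    have hr : locDualHom (L := L) D M (algebraMap R L r) = TrivSqZeroExt.inl (algebraMap R L r) := by
      rw [IsScalarTower.algebraMap_apply R A L, locDualHom_algebraMap]
      ext
      · rw [fst_dualHom, TrivSqZeroExt.fst_inl]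
      · rw [snd_dualHom, TrivSqZeroExt.snd_inl, D.map_algebraMap, map_zero]
    simp only [RingHom.id_apply]
    rw [Algebra.smul_def, map_mul, TrivSqZeroExt.snd_mul, hr, fst_locDualHom, TrivSqZeroExt.fst_inl,
      TrivSqZeroExt.snd_inl, smul_zero, add_zero, smul_eq_mul, ← Algebra.smul_def]
  map_one_eq_zero' := by
    show (locDualHom (L := L) D M 1).snd = 0
    rw [map_one, TrivSqZeroExt.snd_one]
  leibniz' x y := by
    show (locDualHom (L := L) D M (x * y)).snd =
      x • (locDualHom D M y).snd + y • (locDualHom D M x).snd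
    rw [map_mul, TrivSqZeroExt.snd_mul, fst_locDualHom, fst_locDualHom, smul_eq_mul, smul_eq_mul,
      op_smul_eq_mul, mul_comm _ y]

/-- `D_L` extends `D`.
[cite: Eisenbud1995, §16.2 Prop. 16.9 (derivations and differentials localize)] -/
@[simp] theorem locDeriv_algebraMap (a : A) :
    locDeriv (L := L) D M (algebraMap A L a) = algebraMap A L (D a) := by
  show (locDualHom (L := L) D M (algebraMap A L a)).snd = _
  rw [locDualHom_algebraMap, snd_dualHom]

/-- `D_L` is the unique derivation of `L` extending `D`.
[cite: Eisenbud1995, §16.2 Prop. 16.9 (derivations and differentials localize)] -/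
theorem eq_locDeriv {D' : Derivation R L L}
    (h : ∀ a : A, D' (algebraMap A L a) = algebraMap A L (D a)) :
    D' = locDeriv (L := L) D M :=
  derivation_eq_of_algebraMap M fun a => by rw [h, locDeriv_algebraMap]

/-- `D_L` on a fraction `a/m`: the quotient rule `D_L(a/m) · m² = D a · m − a · D m` (in `L`).
[cite: Eisenbud1995, §16.2 Prop. 16.9 (derivations and differentials localize)] -/
theorem locDeriv_mk'_mul (a : A) (m : M) :
    locDeriv (L := L) D M (IsLocalization.mk' L a m) * algebraMap A L m * algebraMap A L m =
      algebraMap A L (D a) * algebraMap A L m - algebraMap A L a * algebraMap A L (D m) := by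
  have e := congr_arg (locDeriv (L := L) D M) (IsLocalization.mk'_spec L a m)
  rw [(locDeriv D M).leibniz, smul_eq_mul, smul_eq_mul, locDeriv_algebraMap,
    locDeriv_algebraMap] at e
  have e2 := IsLocalization.mk'_spec L a m
  linear_combination (algebraMap A L m) * e - (algebraMap A L (D m)) * e2

end LocDeriv

/-! ### The Euler derivation of `K(x)` -/

section EulerFrac

variable (σ : Type*) (K : Type*) [Field K] (L : Type*) [Field L] [Algebra K L]
  [Algebra (MvPolynomial σ K) L] [IsScalarTower K (MvPolynomial σ K) L]
  [IsFractionRing (MvPolynomial σ K) L]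

/-- **The Euler derivation of the rational function field** `K(x) = Frac K[x]` (any model `L`),
extending `euler` by the quotient rule: the graded form of `∂_z` applied to the exact DiDIL
quotients `T_{i,j}/T̃_{m,j}` (DDS21 §3, (3.1)/(3.2), full version p0029 L766–767, p0030 L808–812).
[cite: DuttaDwivediSaxena2022, §3 proof of Thm. 3.2, (3.1)–(3.2) (full version p0029 L766–767, p0030 L808–812)] -/
def eulerFrac : Derivation K L L :=
  locDeriv (euler σ K) (nonZeroDivisors (MvPolynomial σ K))

variable {σ K L}

/-- `E` on `K(x)` extends `E` on `K[x]`.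
[cite: DuttaDwivediSaxena2022, §3 proof of Thm. 3.2, Derive (3.1)–(3.2) (full version p0029 L766–767, p0030 L808–812)] -/
@[simp] theorem eulerFrac_algebraMap (p : MvPolynomial σ K) :
    eulerFrac σ K L (algebraMap (MvPolynomial σ K) L p) = algebraMap (MvPolynomial σ K) L (euler σ K p) :=
  locDeriv_algebraMap _ _ p

/-- **Quotient rule**: `E(a/b) = (E a · b − a · E b)/b²`.
[cite: DuttaDwivediSaxena2022, §3 proof of Thm. 3.2, Derive (3.1)–(3.2) (full version p0029 L766–767, p0030 L808–812)] -/
theorem eulerFrac_div (a b : L) :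
    eulerFrac σ K L (a / b) = (eulerFrac σ K L a * b - a * eulerFrac σ K L b) / b ^ 2 := by
  rw [(eulerFrac σ K L).leibniz_div, smul_sub, smul_eq_mul, smul_eq_mul, smul_eq_mul, inv_pow,
    div_eq_inv_mul]
  ring

/-- Quotient rule for polynomial data: `E(p/q) = (E p · q − p · E q)/q²`.
[cite: DuttaDwivediSaxena2022, §3 proof of Thm. 3.2, Derive (3.1)–(3.2) (full version p0029 L766–767, p0030 L808–812)] -/
theorem eulerFrac_div_algebraMap (p q : MvPolynomial σ K) :
    eulerFrac σ K L (algebraMap _ L p / algebraMap _ L q) =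
      (algebraMap _ L (euler σ K p * q - p * euler σ K q)) / algebraMap _ L q ^ 2 := by
  rw [eulerFrac_div, eulerFrac_algebraMap, eulerFrac_algebraMap, map_sub, map_mul, map_mul]

/-- `E` kills scalars.
[cite: DuttaDwivediSaxena2022, §3 proof of Thm. 3.2, Derive (3.1)–(3.2) (full version p0029 L766–767, p0030 L808–812)] -/
theorem eulerFrac_algebraMap_C (a : K) :
    eulerFrac σ K L (algebraMap (MvPolynomial σ K) L (C a)) = 0 := by
  rw [eulerFrac_algebraMap, euler_C, map_zero]

/-- `E` is the unique derivation of `K(x)` over `K` with `E(x_i) = x_i`… more precisely the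
unique one extending `euler`.
[cite: DuttaDwivediSaxena2022, §3 proof of Thm. 3.2, Derive (3.1)–(3.2) (full version p0029 L766–767, p0030 L808–812)] -/
theorem eq_eulerFrac {D' : Derivation K L L}
    (h : ∀ p : MvPolynomial σ K, D' (algebraMap _ L p) = algebraMap _ L (euler σ K p)) :
    D' = eulerFrac σ K L :=
  eq_locDeriv _ _ h

end EulerFrac

/-! ## §4 Lowest degree and initial form of a polynomial

The graded replacement of the `z`-valuation `val_z` and of "`(·/z^v)|_{z=0}`" in DDS21 §3
(hypotheses (1)–(3), full version p0030 L799–805; `d_{j+1} = d_j − v_j − 1`, p0031 L815):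
`ldeg p` is the order of `p` read as a power series and `initialForm p` its lowest homogeneous
component. Multiplicativity comes from Mathlib's `MvPowerSeries.order_mul`. -/

section LowestDegree

variable {σ : Type*} {R : Type*} [CommSemiring R]

/-- **Lowest total degree** of a polynomial (`0` for the zero polynomial): the order of `p` as
a power series (graded form of DDS21's `z`-valuation `v_{i,j}`).
[cite: DuttaDwivediSaxena2022, §3 proof of Thm. 3.2, induction hypotheses (full version p0030 L799–805)] -/
def ldeg (p : MvPolynomial σ R) : ℕ := ((p : MvPowerSeries σ R).order).toNat

/-- `ldeg 0 = 0`.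
[cite: DuttaDwivediSaxena2022, §3 proof of Thm. 3.2, induction hypotheses (1)–(3) (full version p0030 L799–805)] -/
@[simp] theorem ldeg_zero : ldeg (0 : MvPolynomial σ R) = 0 := by
  simp [ldeg, MvPolynomial.coe_zero]

/-- For `p ≠ 0` the order of `p` as a power series is `ldeg p`.
[cite: DuttaDwivediSaxena2022, §3 proof of Thm. 3.2, induction hypotheses (1)–(3) (full version p0030 L799–805)] -/
theorem order_coe {p : MvPolynomial σ R} (hp : p ≠ 0) : (p : MvPowerSeries σ R).order = ldeg p := by
  have h : (p : MvPowerSeries σ R) ≠ 0 := by rwa [Ne, MvPolynomial.coe_eq_zero_iff]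
  exact (MvPowerSeries.ne_zero_iff_order_finite.1 h).symm

/-- Coefficients below the lowest degree vanish.
[cite: DuttaDwivediSaxena2022, §3 proof of Thm. 3.2, induction hypotheses (1)–(3) (full version p0030 L799–805)] -/
theorem coeff_eq_zero_of_degree_lt_ldeg {p : MvPolynomial σ R} {d : σ →₀ ℕ} (hd : d.degree < ldeg p) :
    coeff d p = 0 := by
  by_cases hp : p = 0
  · rw [hp, coeff_zero]
  · rw [← MvPolynomial.coeff_coe]
    exact MvPowerSeries.coeff_of_lt_order (by rw [order_coe hp]; exact_mod_cast hd)

/-- A nonzero coefficient bounds the lowest degree.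
[cite: DuttaDwivediSaxena2022, §3 proof of Thm. 3.2, induction hypotheses (1)–(3) (full version p0030 L799–805)] -/
theorem ldeg_le_of_coeff_ne_zero {p : MvPolynomial σ R} {d : σ →₀ ℕ} (h : coeff d p ≠ 0) :
    ldeg p ≤ d.degree := by
  by_contra h'
  exact h (coeff_eq_zero_of_degree_lt_ldeg (not_le.1 h'))

/-- Homogeneous components below the lowest degree vanish.
[cite: DuttaDwivediSaxena2022, §3 proof of Thm. 3.2, induction hypotheses (1)–(3) (full version p0030 L799–805)] -/
theorem homogeneousComponent_eq_zero_of_lt_ldeg {p : MvPolynomial σ R} {c : ℕ} (hc : c < ldeg p) :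
    homogeneousComponent c p = 0 := by
  ext d
  rw [coeff_homogeneousComponent, coeff_zero]
  split_ifs with hd
  · exact coeff_eq_zero_of_degree_lt_ldeg (hd ▸ hc)
  · rfl

/-- `ldeg p ≤ totalDegree p`.
[cite: DuttaDwivediSaxena2022, §3 proof of Thm. 3.2, induction hypotheses (1)–(3) (full version p0030 L799–805)] -/
theorem ldeg_le_totalDegree (p : MvPolynomial σ R) : ldeg p ≤ p.totalDegree := by
  by_cases hp : p = 0
  · rw [hp, ldeg_zero]; exact Nat.zero_le _
  · obtain ⟨d, hd⟩ := MvPolynomial.exists_coeff_ne_zero hp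
    have h1 := ldeg_le_of_coeff_ne_zero hd
    have h2 := le_totalDegree (mem_support_iff.2 hd)
    rw [Finsupp.degree_apply] at h1
    exact h1.trans h2

/-- **Initial form**: the lowest-degree homogeneous component (graded form of DDS21's
`(T/z^{v})|_{z=0}`).
[cite: DuttaDwivediSaxena2022, §3 proof of Thm. 3.2, induction hypothesis (3) (full version p0030 L804–805)] -/
def initialForm (p : MvPolynomial σ R) : MvPolynomial σ R := homogeneousComponent (ldeg p) p

/-- The initial form is homogeneous of degree `ldeg p`.
[cite: DuttaDwivediSaxena2022, §3 proof of Thm. 3.2, induction hypotheses (1)–(3) (full version p0030 L799–805)] -/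
theorem isHomogeneous_initialForm (p : MvPolynomial σ R) : (initialForm p).IsHomogeneous (ldeg p) :=
  homogeneousComponent_isHomogeneous _ _

/-- Homogeneous components as power series.
[cite: DuttaDwivediSaxena2022, §3 proof of Thm. 3.2, induction hypotheses (1)–(3) (full version p0030 L799–805)] -/
theorem coe_homogeneousComponent (c : ℕ) (p : MvPolynomial σ R) :
    ((homogeneousComponent c p : MvPolynomial σ R) : MvPowerSeries σ R) =
      MvPowerSeries.homogeneousComponent c (p : MvPowerSeries σ R) := by
  ext d
  rw [MvPolynomial.coeff_coe, coeff_homogeneousComponent, MvPowerSeries.coeff_homogeneousComponent,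
    MvPolynomial.coeff_coe]

/-- The initial form of a nonzero polynomial is nonzero.
[cite: DuttaDwivediSaxena2022, §3 proof of Thm. 3.2, induction hypotheses (1)–(3) (full version p0030 L799–805)] -/
theorem initialForm_ne_zero {p : MvPolynomial σ R} (hp : p ≠ 0) : initialForm p ≠ 0 := by
  intro h
  have h1 := congr_arg (fun q : MvPolynomial σ R => (q : MvPowerSeries σ R)) h
  simp only [initialForm, coe_homogeneousComponent, MvPolynomial.coe_zero] at h1
  exact MvPowerSeries.homogeneousComponent_of_order (order_coe hp).symm h1

/-- `ldeg` of the initial form.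
[cite: DuttaDwivediSaxena2022, §3 proof of Thm. 3.2, induction hypotheses (1)–(3) (full version p0030 L799–805)] -/
theorem ldeg_initialForm {p : MvPolynomial σ R} (hp : p ≠ 0) : ldeg (initialForm p) = ldeg p := by
  have h1 := isHomogeneous_initialForm p
  apply le_antisymm
  · obtain ⟨d, hd'⟩ := MvPolynomial.exists_coeff_ne_zero (initialForm_ne_zero hp)
    have := ldeg_le_of_coeff_ne_zero hd'
    rwa [show d.degree = ldeg p from by
      by_contra hne; exact hd' (h1.coeff_eq_zero hne)] at this
  · by_contra hlt
    rw [not_le] at hlt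
    have h2 : homogeneousComponent (ldeg (initialForm p)) (initialForm p) = 0 := by
      rw [homogeneousComponent_of_mem h1, if_neg (Nat.ne_of_gt hlt).symm]
    exact initialForm_ne_zero (initialForm_ne_zero hp) h2

/-- A nonzero homogeneous polynomial of degree `c` has `ldeg = c` and is its own initial form.
[cite: DuttaDwivediSaxena2022, §3 proof of Thm. 3.2, induction hypotheses (1)–(3) (full version p0030 L799–805)] -/
theorem ldeg_eq_of_isHomogeneous {p : MvPolynomial σ R} {c : ℕ} (h : p.IsHomogeneous c) (hp : p ≠ 0) :
    ldeg p = c := by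
  obtain ⟨d, hd'⟩ := MvPolynomial.exists_coeff_ne_zero hp
  have hdc : d.degree = c := by by_contra hne; exact hd' (h.coeff_eq_zero hne)
  apply le_antisymm
  · exact hdc ▸ ldeg_le_of_coeff_ne_zero hd'
  · by_contra hlt
    rw [not_le] at hlt
    have h2 : homogeneousComponent (ldeg p) p = 0 := by
      rw [homogeneousComponent_of_mem h, if_neg (Nat.ne_of_gt hlt).symm]
    exact initialForm_ne_zero hp h2

/-- A nonzero homogeneous polynomial is its own initial form.
[cite: DuttaDwivediSaxena2022, §3 proof of Thm. 3.2, induction hypotheses (1)–(3) (full version p0030 L799–805)] -/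
theorem initialForm_eq_self_of_isHomogeneous {p : MvPolynomial σ R} {c : ℕ} (h : p.IsHomogeneous c)
    (hp : p ≠ 0) : initialForm p = p := by
  rw [initialForm, ldeg_eq_of_isHomogeneous h hp, homogeneousComponent_of_mem h, if_pos rfl]

/-- `ldeg (C a) = 0`.
[cite: DuttaDwivediSaxena2022, §3 proof of Thm. 3.2, induction hypotheses (1)–(3) (full version p0030 L799–805)] -/
@[simp] theorem ldeg_C (a : R) : ldeg (C a : MvPolynomial σ R) = 0 := by
  by_cases ha : (C a : MvPolynomial σ R) = 0
  · rw [ha, ldeg_zero]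
  · exact ldeg_eq_of_isHomogeneous (isHomogeneous_C σ a) ha

/-- `ldeg (X i) = 1`.
[cite: DuttaDwivediSaxena2022, §3 proof of Thm. 3.2, induction hypotheses (1)–(3) (full version p0030 L799–805)] -/
@[simp] theorem ldeg_X [Nontrivial R] (i : σ) : ldeg (X i : MvPolynomial σ R) = 1 :=
  ldeg_eq_of_isHomogeneous (isHomogeneous_X R i) (X_ne_zero i)

/-- `ldeg p = 0` iff the constant coefficient is nonzero (`p ≠ 0`).
[cite: DuttaDwivediSaxena2022, §3 proof of Thm. 3.2, induction hypotheses (1)–(3) (full version p0030 L799–805)] -/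
theorem ldeg_eq_zero_iff {p : MvPolynomial σ R} (hp : p ≠ 0) : ldeg p = 0 ↔ coeff 0 p ≠ 0 := by
  constructor
  · intro h h0
    apply initialForm_ne_zero hp
    rw [initialForm, h]
    ext d
    rw [coeff_homogeneousComponent, coeff_zero]
    split_ifs with hd
    · rw [Finsupp.degree_eq_zero_iff] at hd
      rw [hd, h0]
    · rfl
  · intro h
    have := ldeg_le_of_coeff_ne_zero h
    rwa [map_zero, Nat.le_zero] at this

/-- **Multiplicativity of the lowest degree** over a domain: `ldeg (p q) = ldeg p + ldeg q`
(`p, q ≠ 0`) — the graded form of `val_z(T·T') = val_z T + val_z T'`.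
[cite: DuttaDwivediSaxena2022, §3 proof of Thm. 3.2, induction hypotheses (1)–(3) (full version p0030 L799–805)] -/
theorem ldeg_mul [NoZeroDivisors R] {p q : MvPolynomial σ R} (hp : p ≠ 0) (hq : q ≠ 0) :
    ldeg (p * q) = ldeg p + ldeg q := by
  have hpq : p * q ≠ 0 := mul_ne_zero hp hq
  have h := MvPowerSeries.order_mul (p : MvPowerSeries σ R) (q : MvPowerSeries σ R)
  rw [← MvPolynomial.coe_mul, order_coe hpq, order_coe hp, order_coe hq] at h
  exact_mod_cast h

/-- **Initial forms multiply**: `in(p q) = in(p) · in(q)`.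
[cite: DuttaDwivediSaxena2022, §3 proof of Thm. 3.2, induction hypotheses (1)–(3) (full version p0030 L799–805)] -/
theorem initialForm_mul [NoZeroDivisors R] (p q : MvPolynomial σ R) :
    initialForm (p * q) = initialForm p * initialForm q := by
  by_cases hp : p = 0
  · simp [hp, initialForm]
  by_cases hq : q = 0
  · simp [hq, initialForm]
  apply MvPolynomial.coe_injective
  rw [MvPolynomial.coe_mul, initialForm, initialForm, initialForm, coe_homogeneousComponent,
    coe_homogeneousComponent, coe_homogeneousComponent, ldeg_mul hp hq, MvPolynomial.coe_mul]
  exact MvPowerSeries.homogeneousComponent_mul_of_le_order (order_coe hp).symm.le (order_coe hq).symm.le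

/-- The lowest degree of a (nonzero) sum is at least the minimum of the lowest degrees.
[cite: DuttaDwivediSaxena2022, §3 proof of Thm. 3.2, induction hypotheses (1)–(3) (full version p0030 L799–805)] -/
theorem min_ldeg_le_ldeg_add {p q : MvPolynomial σ R} (hpq : p + q ≠ 0) :
    min (ldeg p) (ldeg q) ≤ ldeg (p + q) := by
  by_cases hp : p = 0
  · rw [hp, ldeg_zero, zero_add]; exact min_le_of_left_le (Nat.zero_le _)
  by_cases hq : q = 0
  · rw [hq, ldeg_zero, add_zero]; exact min_le_of_right_le (Nat.zero_le _)
  have h := MvPowerSeries.min_order_le_add (f := (p : MvPowerSeries σ R)) (g := (q : MvPowerSeries σ R))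
  rw [← MvPolynomial.coe_add, order_coe hp, order_coe hq, order_coe hpq] at h
  by_contra hlt
  rw [not_le, lt_min_iff] at hlt
  have h2 : ((ldeg (p + q) : ℕ) : ℕ∞) < min ((ldeg p : ℕ) : ℕ∞) ((ldeg q : ℕ) : ℕ∞) :=
    lt_min (by exact_mod_cast hlt.1) (by exact_mod_cast hlt.2)
  exact absurd (h2.trans_le h) (lt_irrefl _)

/-- After removing the initial form the lowest degree goes up (when something is left): the
engine of the graded geometric expansion `1/E = ∑_r (in E − E)^r / in(E)^{r+1}`.
[cite: DuttaDwivediSaxena2022, §3 proof of Thm. 3.2, induction hypotheses (1)–(3) (full version p0030 L799–805)] -/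
theorem ldeg_lt_ldeg_sub_initialForm {R : Type*} [CommRing R] {p : MvPolynomial σ R}
    (h : p - initialForm p ≠ 0) : ldeg p < ldeg (p - initialForm p) := by
  have key : ∀ d : σ →₀ ℕ, d.degree < ldeg p + 1 → coeff d (p - initialForm p) = 0 := by
    intro d hd
    rw [coeff_sub, initialForm, coeff_homogeneousComponent]
    split_ifs with hdeg
    · exact sub_self _
    · rw [sub_zero]
      exact coeff_eq_zero_of_degree_lt_ldeg (by omega)
  have h2 : ((ldeg p + 1 : ℕ) : ℕ∞) ≤ ((p - initialForm p : MvPolynomial σ R) : MvPowerSeries σ R).order :=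
    MvPowerSeries.nat_le_order fun d hd => by
      rw [MvPolynomial.coeff_coe]; exact key d (by exact_mod_cast hd)
  rw [order_coe h] at h2
  have h3 : ldeg p + 1 ≤ ldeg (p - initialForm p) := by exact_mod_cast h2
  omega

/-- **Graded geometric identity** for a non-unit denominator: with `H := in(E)` and
`E' := H − E` (so `ldeg E' > ldeg E` when `E' ≠ 0`, `ldeg_lt_ldeg_sub_initialForm`),
`E · ∑_{i<r} H^i E'^{r−1−i} = H^r − E'^r`; dividing by `H^r E` expands `1/E` into terms with the
HOMOGENEOUS denominators `H^{i+1}` plus the error `E'^r/(H^r E)` of graded valuation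
`≥ r·(ldeg E + 1) − (r + 1)·ldeg E = r − ldeg E` (the graded division B5 consumes).
[cite: DuttaDwivediSaxena2022, §3 proof of Thm. 3.2, induction hypotheses (1)–(3) (full version p0030 L799–805)] -/
theorem mul_geom_sum₂_initialForm {R : Type*} [CommRing R] (E : MvPolynomial σ R) (r : ℕ) :
    E * ∑ i ∈ Finset.range r, initialForm E ^ i * (initialForm E - E) ^ (r - 1 - i) =
      initialForm E ^ r - (initialForm E - E) ^ r := by
  have h := (Commute.all (initialForm E) (initialForm E - E)).geom_sum₂_mul r
  rw [sub_sub_cancel] at h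
  rw [← h, mul_comm]

end LowestDegree

/-! ## §5 Graded expansion of fractions with unit denominators

Certificates of the DiDIL bookkeeping (memo R1): an exact term carries `P = p/Π` with
`Π(0) ≠ 0` (a product of shifted affine forms `ℓ(α) + ℓ_lin`, `ℓ(α) ≠ 0`, DDS21 §3: "Φ(T_{i,0})
is invertible", full version p0028 L753–754); its degree-`c` graded piece `gcomp p Π c` is a
POLYNOMIAL and the pieces obey the product / sum / Euler rules exactly. -/

section UnitDenominators

variable {σ : Type*} [Fintype σ] [DecidableEq σ] {K : Type*} [Field K]

omit [Fintype σ] [DecidableEq σ] in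
/-- Constant coefficient of a polynomial read as a power series.
[cite: DuttaDwivediSaxena2022, §3 proof of Claim 3.3 and eq. (3.3) (full version p0027 L737–744, p0032 L858–862)] -/
theorem constantCoeff_coe (Q : MvPolynomial σ K) :
    MvPowerSeries.constantCoeff (Q : MvPowerSeries σ K) = coeff 0 Q := by
  rw [← MvPowerSeries.coeff_zero_eq_constantCoeff_apply, MvPolynomial.coeff_coe]

omit [Fintype σ] [DecidableEq σ] in
/-- The coercion to power series commutes with negation.
[cite: DuttaDwivediSaxena2022, §3 proof of Claim 3.3 and eq. (3.3) (full version p0027 L737–744, p0032 L858–862)] -/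
theorem coe_neg' {R : Type*} [CommRing R] (p : MvPolynomial σ R) :
    ((-p : MvPolynomial σ R) : MvPowerSeries σ R) = -(p : MvPowerSeries σ R) :=
  (coeToMvPowerSeries.ringHom (σ := σ) (R := R)).map_neg p

omit [Fintype σ] [DecidableEq σ] in
/-- The coercion to power series commutes with subtraction.
[cite: DuttaDwivediSaxena2022, §3 proof of Claim 3.3 and eq. (3.3) (full version p0027 L737–744, p0032 L858–862)] -/
theorem coe_sub' {R : Type*} [CommRing R] (p q : MvPolynomial σ R) :
    ((p - q : MvPolynomial σ R) : MvPowerSeries σ R) = (p : MvPowerSeries σ R) - q :=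
  (coeToMvPowerSeries.ringHom (σ := σ) (R := R)).map_sub p q

omit [Fintype σ] [DecidableEq σ] in
/-- Constant coefficient of a product.
[cite: DuttaDwivediSaxena2022, §3 proof of Claim 3.3 and eq. (3.3) (full version p0027 L737–744, p0032 L858–862)] -/
theorem coeff_zero_mul' (p q : MvPolynomial σ K) : coeff 0 (p * q) = coeff 0 p * coeff 0 q := by
  rw [← constantCoeff_eq, map_mul]

/-- **Graded pieces of a fraction with unit denominator**: `gcomp p Q c` is the degree-`c`
homogeneous part of the power series `p · Q⁻¹` (`Q(0) ≠ 0`), i.e. the coefficient of `z^c` in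
DDS21's `R_j`-expansion of `P/Q` ("`1/R` does not contain negative powers", full version p0027
L737–744; the truncated `dlog` series (3.3), p0032 L858–862).
[cite: DuttaDwivediSaxena2022, §3 proof of Thm. 3.2, Claim 3.3 and eq. (3.3) (full version p0027 L737–744, p0032 L858–862)] -/
def gcomp (p Q : MvPolynomial σ K) (c : ℕ) : MvPolynomial σ K :=
  hpart c ((p : MvPowerSeries σ K) * (Q : MvPowerSeries σ K)⁻¹)

/-- `gcomp` unfolds.
[cite: DuttaDwivediSaxena2022, §3 proof of Claim 3.3 and eq. (3.3) (full version p0027 L737–744, p0032 L858–862)] -/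
theorem gcomp_def (p Q : MvPolynomial σ K) (c : ℕ) :
    gcomp p Q c = hpart c ((p : MvPowerSeries σ K) * (Q : MvPowerSeries σ K)⁻¹) := rfl

/-- `gcomp p Q c` is homogeneous of degree `c`.
[cite: DuttaDwivediSaxena2022, §3 proof of Claim 3.3 and eq. (3.3) (full version p0027 L737–744, p0032 L858–862)] -/
theorem isHomogeneous_gcomp (p Q : MvPolynomial σ K) (c : ℕ) : (gcomp p Q c).IsHomogeneous c :=
  isHomogeneous_hpart c _

omit [Fintype σ] [DecidableEq σ] in
/-- The expansion `p · Q⁻¹` is characterised by `(p Q⁻¹) · Q = p` when `Q(0) ≠ 0`.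
[cite: DuttaDwivediSaxena2022, §3 proof of Claim 3.3 and eq. (3.3) (full version p0027 L737–744, p0032 L858–862)] -/
theorem coe_mul_inv_eq_iff {p Q : MvPolynomial σ K} (hQ : coeff 0 Q ≠ 0) (φ : MvPowerSeries σ K) :
    φ = (p : MvPowerSeries σ K) * (Q : MvPowerSeries σ K)⁻¹ ↔ φ * Q = p :=
  MvPowerSeries.eq_mul_inv_iff_mul_eq (by rwa [constantCoeff_coe])

/-- **Representation independence**: `p/Q = p'/Q'` as fractions (`p Q' = p' Q`) gives the same
graded pieces.
[cite: DuttaDwivediSaxena2022, §3 proof of Claim 3.3 and eq. (3.3) (full version p0027 L737–744, p0032 L858–862)] -/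
theorem gcomp_congr {p p' Q Q' : MvPolynomial σ K} (hQ : coeff 0 Q ≠ 0) (hQ' : coeff 0 Q' ≠ 0)
    (h : p * Q' = p' * Q) : gcomp p Q = gcomp p' Q' := by
  funext c
  rw [gcomp_def, gcomp_def]
  congr 1
  rw [coe_mul_inv_eq_iff hQ', mul_assoc, mul_comm ((Q : MvPowerSeries σ K)⁻¹), ← mul_assoc,
    ← MvPolynomial.coe_mul, h, MvPolynomial.coe_mul, mul_assoc,
    MvPowerSeries.mul_inv_cancel _ (by rwa [constantCoeff_coe]), mul_one]

/-- Denominator `1`: the graded pieces of a polynomial are its homogeneous components.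
[cite: DuttaDwivediSaxena2022, §3 proof of Claim 3.3 and eq. (3.3) (full version p0027 L737–744, p0032 L858–862)] -/
theorem gcomp_one (p : MvPolynomial σ K) (c : ℕ) : gcomp p 1 c = homogeneousComponent c p := by
  rw [gcomp_def, MvPolynomial.coe_one, inv_one, mul_one, hpart_coe]

/-- `gcomp 0 Q = 0`.
[cite: DuttaDwivediSaxena2022, §3 proof of Claim 3.3 and eq. (3.3) (full version p0027 L737–744, p0032 L858–862)] -/
@[simp] theorem gcomp_zero (Q : MvPolynomial σ K) (c : ℕ) : gcomp 0 Q c = 0 := by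
  rw [gcomp_def, MvPolynomial.coe_zero, zero_mul, map_zero]

/-- Linearity in the numerator: scalars.
[cite: DuttaDwivediSaxena2022, §3 proof of Claim 3.3 and eq. (3.3) (full version p0027 L737–744, p0032 L858–862)] -/
theorem gcomp_C_mul (a : K) (p Q : MvPolynomial σ K) (c : ℕ) :
    gcomp (C a * p) Q c = a • gcomp p Q c := by
  rw [gcomp_def, gcomp_def, MvPolynomial.coe_mul, MvPolynomial.coe_C, mul_assoc,
    ← MvPowerSeries.smul_eq_C_mul, map_smul]

/-- Linearity in the numerator: sums over a common denominator.
[cite: DuttaDwivediSaxena2022, §3 proof of Claim 3.3 and eq. (3.3) (full version p0027 L737–744, p0032 L858–862)] -/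
theorem gcomp_add_left (p p' Q : MvPolynomial σ K) (c : ℕ) :
    gcomp (p + p') Q c = gcomp p Q c + gcomp p' Q c := by
  rw [gcomp_def, gcomp_def, gcomp_def, MvPolynomial.coe_add, add_mul, map_add]

/-- Linearity in the numerator: negation.
[cite: DuttaDwivediSaxena2022, §3 proof of Claim 3.3 and eq. (3.3) (full version p0027 L737–744, p0032 L858–862)] -/
theorem gcomp_neg_left (p Q : MvPolynomial σ K) (c : ℕ) : gcomp (-p) Q c = -gcomp p Q c := by
  rw [gcomp_def, gcomp_def, coe_neg', neg_mul, map_neg]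

/-- Linearity in the numerator: differences.
[cite: DuttaDwivediSaxena2022, §3 proof of Claim 3.3 and eq. (3.3) (full version p0027 L737–744, p0032 L858–862)] -/
theorem gcomp_sub_left (p p' Q : MvPolynomial σ K) (c : ℕ) :
    gcomp (p - p') Q c = gcomp p Q c - gcomp p' Q c := by
  rw [sub_eq_add_neg, gcomp_add_left, gcomp_neg_left, ← sub_eq_add_neg]

/-- **Product rule** (Cauchy by degree): the graded pieces of `(p₁/Q₁)(p₂/Q₂) = p₁p₂/(Q₁Q₂)`
are the convolution of the pieces — the calculus behind "`Σ∧Σ` closed under multiplication"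
applied coefficientwise in `z` (DDS21 Lemma 2.12/2.13 used in Claim 3.6, full version p0033 L876–887).
[cite: DuttaDwivediSaxena2022, §3 proof of Claim 3.6 (full version p0033 L876–887)] -/
theorem gcomp_mul (p₁ Q₁ p₂ Q₂ : MvPolynomial σ K) (c : ℕ) :
    gcomp (p₁ * p₂) (Q₁ * Q₂) c = ∑ ij ∈ antidiagonal c, gcomp p₁ Q₁ ij.1 * gcomp p₂ Q₂ ij.2 := by
  rw [gcomp_def, MvPolynomial.coe_mul, MvPolynomial.coe_mul, MvPowerSeries.mul_inv_rev,
    show ((p₁ : MvPowerSeries σ K) * p₂) * ((Q₂ : MvPowerSeries σ K)⁻¹ * (Q₁ : MvPowerSeries σ K)⁻¹) =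
      ((p₁ : MvPowerSeries σ K) * (Q₁ : MvPowerSeries σ K)⁻¹) * ((p₂ : MvPowerSeries σ K) * (Q₂ : MvPowerSeries σ K)⁻¹)
      from by ring, hpart_mul]
  rfl

/-- **Sum rule**: `p₁/Q₁ + p₂/Q₂ = (p₁Q₂ + p₂Q₁)/(Q₁Q₂)` piecewise (`Q₁(0), Q₂(0) ≠ 0`).
[cite: DuttaDwivediSaxena2022, §3 proof of Claim 3.3 and eq. (3.3) (full version p0027 L737–744, p0032 L858–862)] -/
theorem gcomp_add (p₁ p₂ : MvPolynomial σ K) {Q₁ Q₂ : MvPolynomial σ K} (hQ₁ : coeff 0 Q₁ ≠ 0)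
    (hQ₂ : coeff 0 Q₂ ≠ 0) (c : ℕ) :
    gcomp (p₁ * Q₂ + p₂ * Q₁) (Q₁ * Q₂) c = gcomp p₁ Q₁ c + gcomp p₂ Q₂ c := by
  rw [gcomp_def, gcomp_def, gcomp_def, ← map_add]
  congr 1
  rw [← constantCoeff_coe] at hQ₁ hQ₂
  have h1 := MvPowerSeries.mul_inv_cancel _ hQ₁
  have h2 := MvPowerSeries.mul_inv_cancel _ hQ₂
  rw [MvPolynomial.coe_add, MvPolynomial.coe_mul, MvPolynomial.coe_mul, MvPolynomial.coe_mul,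
    MvPowerSeries.mul_inv_rev]
  linear_combination ((p₁ : MvPowerSeries σ K) * (Q₁ : MvPowerSeries σ K)⁻¹) * h2 +
    ((p₂ : MvPowerSeries σ K) * (Q₂ : MvPowerSeries σ K)⁻¹) * h1

/-- Extending the fraction: `(p R)/(Q R)` has the pieces of `p/Q` (`Q(0), R(0) ≠ 0`).
[cite: DuttaDwivediSaxena2022, §3 proof of Claim 3.3 and eq. (3.3) (full version p0027 L737–744, p0032 L858–862)] -/
theorem gcomp_mul_mul {p Q R' : MvPolynomial σ K} (hQ : coeff 0 Q ≠ 0) (hR : coeff 0 R' ≠ 0) :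
    gcomp (p * R') (Q * R') = gcomp p Q :=
  gcomp_congr (by rw [coeff_zero_mul']; exact mul_ne_zero hQ hR) hQ (by ring)

/-- **Euler rule**: `E(p/Q) = (E p · Q − p · E Q)/Q²` piecewise, and `E` multiplies the
degree-`c` piece by `c` (the graded `z∂_z` is diagonal — DDS21's "Derive" step costs nothing on
certificates, cf. Lemma 2.15, full version p0032 L869–871).
[cite: DuttaDwivediSaxena2022, §3 proof of Claim 3.6, differentiation step (full version p0032 L869–871)] -/
theorem gcomp_euler (p : MvPolynomial σ K) {Q : MvPolynomial σ K} (hQ : coeff 0 Q ≠ 0) (c : ℕ) :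
    gcomp (euler σ K p * Q - p * euler σ K Q) (Q ^ 2) c = (c : K) • gcomp p Q c := by
  rw [gcomp_def, gcomp_def, ← hpart_eulerSeries]
  congr 1
  rw [← constantCoeff_coe] at hQ
  rw [eulerSeries_mul_inv _ _ hQ, eulerSeries_coe, eulerSeries_coe, MvPolynomial.coe_pow, sq,
    MvPowerSeries.mul_inv_rev, coe_sub', MvPolynomial.coe_mul, MvPolynomial.coe_mul]
  ring

/-- The jet of a series with large order vanishes.
[cite: DuttaDwivediSaxena2022, §3 proof of Claim 3.3 and eq. (3.3) (full version p0027 L737–744, p0032 L858–862)] -/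
theorem jet_eq_zero_of_le_order {N : ℕ} {φ : MvPowerSeries σ K} (h : (N : ℕ∞) ≤ φ.order) :
    jet N φ = 0 := by
  ext d
  rw [coeff_jet, coeff_zero]
  split_ifs with hd
  · exact MvPowerSeries.coeff_of_lt_order (lt_of_lt_of_le (by exact_mod_cast hd) h)
  · rfl

/-- The jet of (the series of) a jet.
[cite: DuttaDwivediSaxena2022, §3 proof of Claim 3.3 and eq. (3.3) (full version p0027 L737–744, p0032 L858–862)] -/
theorem jet_coe_jet (N : ℕ) (φ : MvPowerSeries σ K) :
    jet N ((jet N φ : MvPolynomial σ K) : MvPowerSeries σ K) = jet N φ := by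
  ext d
  rw [coeff_jet, coeff_jet, MvPolynomial.coeff_coe, coeff_jet]
  split_ifs <;> rfl

/-- The jet only sees the jet of a factor.
[cite: DuttaDwivediSaxena2022, §3 proof of Claim 3.3 and eq. (3.3) (full version p0027 L737–744, p0032 L858–862)] -/
theorem jet_mul_coe_jet (N : ℕ) (φ ψ : MvPowerSeries σ K) :
    jet N (φ * ((jet N ψ : MvPolynomial σ K) : MvPowerSeries σ K)) = jet N (φ * ψ) := by
  rw [← jet_mul_jet, jet_coe_jet, jet_mul_jet]

/-- **The pieces solve the division**: `Q · ∑_{c<N} gcomp p Q c ≡ p` below degree `N` — the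
graded form of "`R⁻¹` exists in `R_j`" (DDS21 Claim 3.3 proof, full version p0027 L737–744).
[cite: DuttaDwivediSaxena2022, §3 proof of Claim 3.3 (full version p0027 L737–744)] -/
theorem jet_mul_sum_gcomp {p Q : MvPolynomial σ K} (hQ : coeff 0 Q ≠ 0) (N : ℕ) :
    jet N ((Q * ∑ c ∈ Finset.range N, gcomp p Q c : MvPolynomial σ K) : MvPowerSeries σ K) =
      jet N (p : MvPowerSeries σ K) := by
  have h : ∑ c ∈ Finset.range N, gcomp p Q c =
      jet N ((p : MvPowerSeries σ K) * (Q : MvPowerSeries σ K)⁻¹) := by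
    rw [jet_eq_sum_hpart]; rfl
  rw [h, MvPolynomial.coe_mul, jet_mul_coe_jet, mul_comm, mul_assoc,
    MvPowerSeries.inv_mul_cancel _ (by rwa [constantCoeff_coe]), mul_one]

/-- **Uniqueness of graded division**: if `Q · r ≡ p` below degree `N` (`Q(0) ≠ 0`) then the
homogeneous components of `r` below `N` are the `gcomp p Q c`.
[cite: DuttaDwivediSaxena2022, §3 proof of Claim 3.3 and eq. (3.3) (full version p0027 L737–744, p0032 L858–862)] -/
theorem homogeneousComponent_eq_gcomp {p Q r : MvPolynomial σ K} (hQ : coeff 0 Q ≠ 0) {N : ℕ}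
    (h : jet N ((Q * r : MvPolynomial σ K) : MvPowerSeries σ K) = jet N (p : MvPowerSeries σ K))
    {c : ℕ} (hc : c < N) : homogeneousComponent c r = gcomp p Q c := by
  have hQ' : MvPowerSeries.constantCoeff (Q : MvPowerSeries σ K) ≠ 0 := by rwa [constantCoeff_coe]
  have h1 : jet N (r : MvPowerSeries σ K) = jet N ((p : MvPowerSeries σ K) * (Q : MvPowerSeries σ K)⁻¹) := by
    have e : (r : MvPowerSeries σ K) = (Q : MvPowerSeries σ K)⁻¹ * ((Q * r : MvPolynomial σ K)) := by
      rw [MvPolynomial.coe_mul, ← mul_assoc, MvPowerSeries.inv_mul_cancel _ hQ', one_mul]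
    rw [e, ← jet_mul_coe_jet, h, jet_mul_coe_jet, mul_comm]
  have h2 := congr_arg (fun q : MvPolynomial σ K => hpart c (q : MvPowerSeries σ K)) h1
  simp only [hpart_coe_jet, if_pos hc] at h2
  rw [hpart_coe] at h2
  exact h2

/-- The truncated inverse with explicit inverses: `∑_{i≤c} a^{-(i+1)} (a − Q)^i`, `a = Q(0)`.
[cite: DuttaDwivediSaxena2022, §3 proof of Claim 3.3 and eq. (3.3) (full version p0027 L737–744, p0032 L858–862)] -/
def invJet (c : ℕ) (Q : MvPolynomial σ K) : MvPolynomial σ K :=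
  ∑ i ∈ Finset.range (c + 1), C ((coeff 0 Q)⁻¹ ^ (i + 1)) * (C (coeff 0 Q) - Q) ^ i

/-- **Division-free formula with inverted constant**: `gcomp p Q c` is the degree-`c` component
of the POLYNOMIAL `p · invJet c Q` ("`1/(1 − A_i) … inverse … mod`", DDS21 Claim 3.3 proof,
full version p0027 L740–744).
[cite: DuttaDwivediSaxena2022, §3 proof of Claim 3.3 (full version p0027 L740–744)] -/
theorem gcomp_eq_homogeneousComponent_mul_invJet {p Q : MvPolynomial σ K} (hQ : coeff 0 Q ≠ 0) (c : ℕ) :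
    gcomp p Q c = homogeneousComponent c (p * invJet c Q) := by
  symm
  refine homogeneousComponent_eq_gcomp hQ (N := c + 1) ?_ (Nat.lt_succ_self c)
  set a := coeff 0 Q with ha
  set w : MvPolynomial σ K := C a⁻¹ * (C a - Q) with hw
  have hw0 : coeff 0 w = 0 := by
    rw [hw, coeff_C_mul, coeff_sub, coeff_C, if_pos rfl, ← ha, sub_self, mul_zero]
  -- `Q · invJet = (1 - w) · ∑_{i≤c} w^i = 1 - w^{c+1}`
  have hQw : Q * invJet c Q = 1 - w ^ (c + 1) := by
    have e1 : invJet c Q = C a⁻¹ * ∑ i ∈ Finset.range (c + 1), w ^ i := by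
      rw [invJet, Finset.mul_sum]
      refine Finset.sum_congr rfl fun i _ => ?_
      rw [hw, mul_pow, ← map_pow, ← mul_assoc, ← map_mul, ← pow_succ', ha]
    have e2 : Q * C a⁻¹ = 1 - w := by
      rw [hw, mul_sub, ← map_mul, inv_mul_cancel₀ hQ, map_one, mul_comm]
      ring
    rw [e1, ← mul_assoc, e2, mul_neg_geom_sum]
  rw [mul_left_comm, hQw, mul_sub, mul_one, coe_sub', map_sub, sub_eq_self, MvPolynomial.coe_mul,
    MvPolynomial.coe_pow]
  refine jet_eq_zero_of_le_order (((MvPowerSeries.le_order_pow_of_constantCoeff_eq_zero (c + 1)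
    (by rw [constantCoeff_coe, hw0])).trans le_add_self).trans MvPowerSeries.le_order_mul)

/-- The truncated inverse cleared of inverses: `adjJet c Q := ∑_{i≤c} a^{c−i} (a − Q)^i`,
`a = Q(0)` — a polynomial expression in `Q` over any commutative ring, compatible with `map`.
[cite: DuttaDwivediSaxena2022, §3 proof of Claim 3.3 and eq. (3.3) (full version p0027 L737–744, p0032 L858–862)] -/
def adjJet {R : Type*} [CommRing R] (c : ℕ) (Q : MvPolynomial σ R) : MvPolynomial σ R :=
  ∑ i ∈ Finset.range (c + 1), C (coeff 0 Q ^ (c - i)) * (C (coeff 0 Q) - Q) ^ i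

omit [Fintype σ] [DecidableEq σ] in
/-- `adjJet` commutes with ring maps on coefficients (e.g. reduction modulo `ε`).
[cite: DuttaDwivediSaxena2022, §3 proof of Claim 3.3 and eq. (3.3) (full version p0027 L737–744, p0032 L858–862)] -/
theorem map_adjJet {R S : Type*} [CommRing R] [CommRing S] (f : R →+* S) (c : ℕ) (Q : MvPolynomial σ R) :
    map f (adjJet c Q) = adjJet c (map f Q) := by
  simp only [adjJet, map_sum, map_mul, map_pow, map_sub, map_C, coeff_map]

/-- **Division-free formula, cleared**: `a^{c+1} · gcomp p Q c = (p · adjJet c Q)_c` with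
`a = Q(0) ≠ 0` — the form that reduces modulo `ε` (for the `ε`-side of the DiDIL end game).
[cite: DuttaDwivediSaxena2022, §3 proof of Claim 3.3 and eq. (3.3) (full version p0027 L737–744, p0032 L858–862)] -/
theorem C_pow_mul_gcomp {p Q : MvPolynomial σ K} (hQ : coeff 0 Q ≠ 0) (c : ℕ) :
    C (coeff 0 Q ^ (c + 1)) * gcomp p Q c = homogeneousComponent c (p * adjJet c Q) := by
  rw [gcomp_eq_homogeneousComponent_mul_invJet hQ, ← homogeneousComponent_C_mul, mul_left_comm,
    invJet, adjJet, Finset.mul_sum, Finset.mul_sum, Finset.mul_sum]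
  congr 1
  refine Finset.sum_congr rfl fun i hi => ?_
  rw [Finset.mem_range] at hi
  have hsc : coeff 0 Q ^ (c + 1) * (coeff 0 Q)⁻¹ ^ (i + 1) = coeff 0 Q ^ (c - i) := by
    rw [inv_pow, ← pow_sub₀ _ hQ (by omega), Nat.add_sub_add_right]
  rw [← mul_assoc (C _) (C _), ← map_mul, hsc]

end UnitDenominators

/-! ### The model computation: inverse of an affine form (DDS21 eq. (3.3))

"`1/(A − zB) = (1/A) ∑_i (zB/A)^i`" (full version p0032 L858–862): for `ℓ = a + m`, `a ≠ 0`,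
`m` linear, the degree-`c` piece of `1/ℓ` is `(−1)^c a^{−(c+1)} m^c` and that of `m/ℓ = Eℓ/ℓ`
(`c ≥ 1`) is `(−1)^{c−1} a^{−c} m^c` — ONE power of a linear form, a `Σ∧Σ` circuit of top
fan-in `1`. -/

section Affine

variable {σ : Type*} [Fintype σ] [DecidableEq σ] {K : Type*} [Field K]

/-- Graded pieces of `1/(a + m)`, `m` homogeneous of degree `1`, `a ≠ 0`:
`(−a⁻¹)^c · a⁻¹ · m^c`.
[cite: DuttaDwivediSaxena2022, §3 eq. (3.3) (full version p0032 L858–862)] -/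
theorem gcomp_one_affine {a : K} (ha : a ≠ 0) {m : MvPolynomial σ K} (hm : m.IsHomogeneous 1) (c : ℕ) :
    gcomp 1 (C a + m) c = C ((-a⁻¹) ^ c * a⁻¹) * m ^ c := by
  have hm0 : coeff 0 m = 0 := hm.coeff_eq_zero (by rw [map_zero]; exact zero_ne_one)
  have h0 : coeff 0 (C a + m) = a := by rw [coeff_add, coeff_C, if_pos rfl, hm0, add_zero]
  rw [gcomp_eq_homogeneousComponent_mul_invJet (by rwa [h0]), one_mul, invJet, h0,
    map_sum (homogeneousComponent c)]
  have hterm : ∀ i, homogeneousComponent c (C (a⁻¹ ^ (i + 1)) * (C a - (C a + m)) ^ i) =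
      if c = i then C ((-a⁻¹) ^ c * a⁻¹) * m ^ c else 0 := by
    intro i
    rw [show C a - (C a + m) = C (-1) * m from by rw [map_neg, map_one]; ring, mul_pow, ← map_pow,
      ← mul_assoc, ← map_mul, homogeneousComponent_C_mul,
      homogeneousComponent_of_mem (by simpa using hm.pow i)]
    split_ifs with h
    · subst h; congr 2; rw [neg_pow, inv_pow]; ring
    · rw [mul_zero]
  simp_rw [hterm]
  rw [Finset.sum_ite_eq, if_pos (Finset.mem_range.2 (Nat.lt_succ_self c))]

/-- Graded pieces of `m/(a + m)` (`= Eℓ/ℓ` for `ℓ = a + m`), degree `c ≥ 1`: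
`−(−a⁻¹)^c · m^c = (−1)^{c−1} a^{−c} m^c`; the piece of degree `0` vanishes.
[cite: DuttaDwivediSaxena2022, §3 eq. (3.3) (full version p0032 L858–862)] -/
theorem gcomp_linear_affine {a : K} (ha : a ≠ 0) {m : MvPolynomial σ K} (hm : m.IsHomogeneous 1) (c : ℕ) :
    gcomp m (C a + m) c = if c = 0 then 0 else C (-(-a⁻¹) ^ c) * m ^ c := by
  have hm0 : coeff 0 m = 0 := hm.coeff_eq_zero (by rw [map_zero]; exact zero_ne_one)
  have h0 : coeff 0 (C a + m) ≠ 0 := by rw [coeff_add, coeff_C, if_pos rfl, hm0, add_zero]; exact ha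
  -- `m/ℓ = 1 - a/ℓ`
  have e : m = (C a + m) - C a * 1 := by ring
  rw [show gcomp m (C a + m) c = gcomp ((C a + m) - C a * 1) (C a + m) c from by rw [← e],
    gcomp_sub_left, gcomp_C_mul, gcomp_one_affine ha hm,
    gcomp_congr h0 (p' := 1) (Q' := 1) (by rw [coeff_zero_one]; exact one_ne_zero) (by ring)]
  simp only [gcomp_one, homogeneousComponent_of_mem (isHomogeneous_one σ K)]
  split_ifs with hc
  · subst hc
    rw [pow_zero, pow_zero, one_mul, mul_one, smul_eq_C_mul, ← map_mul, mul_inv_cancel₀ ha, map_one,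
      sub_self]
  · rw [zero_sub, smul_eq_C_mul, ← mul_assoc, ← map_mul, ← neg_mul, ← map_neg, mul_left_comm,
      mul_inv_cancel₀ ha, mul_one]

end Affine

/-! ## §6 Graded pieces of `Σ∧Σ` circuits

The certificates are `Σ∧Σ` memberships of graded pieces; homogeneous components and jets of a
`Σ∧Σ(t, e)` circuit are again `Σ∧Σ` circuits with the same top fan-in per degree (expand
`(a + m)^e` binomially: the degree-`u` piece is `C(e,u) a^{e−u} m^u`). -/

section SwsGraded

variable {K : Type*} [Field K] {n : ℕ}

/-- Degree-`u` component of a power of an affine form: `((a + m)^e)_u = C(e,u) a^{e−u} m^u`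
(`m` the linear part), zero for `u > e`.
[cite: DuttaDwivediSaxena2022, Lemma 2.14 (full version p0021 L571–576)] -/
theorem homogeneousComponent_affinePow (a : Option (Fin n) → K) (e u : ℕ) :
    homogeneousComponent u ((C (a none) + ∑ m, C (a (some m)) * X m : MvPolynomial (Fin n) K) ^ e) =
      if u ≤ e then C ((e.choose u : K) * a none ^ (e - u)) * (∑ m, C (a (some m)) * X m) ^ u
      else 0 := by
  set L : MvPolynomial (Fin n) K := ∑ m, C (a (some m)) * X m with hL
  have hLh : L.IsHomogeneous 1 := by
    rw [hL]
    refine IsHomogeneous.sum _ _ 1 fun m _ => ?_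
    exact isHomogeneous_C_mul_X _ m
  rw [add_comm, add_pow, map_sum (homogeneousComponent u)]
  have hterm : ∀ i ∈ Finset.range (e + 1),
      homogeneousComponent u (L ^ i * C (a none) ^ (e - i) * (e.choose i : MvPolynomial (Fin n) K)) =
        if u = i then C ((e.choose u : K) * a none ^ (e - u)) * L ^ u else 0 := by
    intro i _
    rw [show L ^ i * C (a none) ^ (e - i) * (e.choose i : MvPolynomial (Fin n) K) =
        C ((e.choose i : K) * a none ^ (e - i)) * L ^ i from by
          rw [map_mul, map_pow, map_natCast]; ring,
      homogeneousComponent_C_mul, homogeneousComponent_of_mem (by simpa using hLh.pow i)]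
    split_ifs with h
    · subst h; rfl
    · rw [mul_zero]
  rw [Finset.sum_congr rfl hterm, Finset.sum_ite_eq]
  simp only [Finset.mem_range, Nat.lt_succ_iff]

/-- **Homogeneous components of a `Σ∧Σ` circuit**: `f ∈ Σ∧Σ(t, e)` ⇒ `f_u ∈ Σ∧Σ(t, u)` (same
top fan-in; each `c (a+m)^{e_i}` contributes `c·C(e_i,u)·a^{e_i−u}·m^u`). The graded form of
DDS21's use of Lemma 2.14 (coefficient extraction in `z`), full version p0021 L571–576.
[cite: DuttaDwivediSaxena2022, Lemma 2.14 (full version p0021 L571–576)] -/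
theorem homogeneousComponent_mem_swsClass {t e : ℕ} {f : MvPolynomial (Fin n) K}
    (hf : f ∈ swsClass K n t e) (u : ℕ) : homogeneousComponent u f ∈ swsClass K n t u := by
  classical
  obtain ⟨c, α, ex, hex, rfl⟩ := hf
  rw [map_sum (homogeneousComponent u)]
  have h := sum_univ_mem_swsClass (K := K) (n := n) (t := 1) (e := u)
    (fun i => homogeneousComponent u (C (c i) * (C (α i none) + ∑ m, C (α i (some m)) * X m) ^ ex i))
    fun i => by
      rw [homogeneousComponent_C_mul, homogeneousComponent_affinePow]
      split_ifs with hu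
      · rw [← mul_assoc, ← map_mul]
        have h := C_mul_affinePow_mem_swsClass (n := n) (t := 1) (e := u) (k := u) le_rfl le_rfl
          (c i * ((ex i).choose u * α i none ^ (ex i - u))) (fun o => Option.elim o 0 (fun m => α i (some m)))
        simpa using h
      · rw [mul_zero]; exact zero_mem_swsClass 1 u
  simpa [Fintype.card_fin] using h

/-- **Jets of a `Σ∧Σ` circuit**: `∑_{u<N} f_u ∈ Σ∧Σ(N·t, e)` for `f ∈ Σ∧Σ(t, e)`.
[cite: DuttaDwivediSaxena2022, Lemma 2.14 (full version p0021 L571–576)] -/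
theorem sum_homogeneousComponent_mem_swsClass {t e : ℕ} {f : MvPolynomial (Fin n) K}
    (hf : f ∈ swsClass K n t e) (N : ℕ) :
    ∑ u ∈ Finset.range N, homogeneousComponent u f ∈ swsClass K n (N * t) e := by
  have h := sum_mem_swsClass (K := K) (n := n) (t := t) (e := e) (Finset.range N)
    (fun u => homogeneousComponent u f) fun u _ => by
      by_cases hu : u ≤ e
      · exact swsClass_mono le_rfl hu (homogeneousComponent_mem_swsClass hf u)
      · rw [homogeneousComponent_eq_zero _ _
          (lt_of_le_of_lt (totalDegree_le_of_mem_swsClass hf) (not_le.1 hu))]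
        exact zero_mem_swsClass t e
  rwa [Finset.card_range] at h

end SwsGraded


end DDS2021

end Literature.Computability.AlgebraicComplexity

end
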